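import Literature.MathematicalPhysics.QuantumFieldTheory.Balaban1983to89.StrongCouplingKernelWindow
import Literature.MathematicalPhysics.QuantumFieldTheory.Balaban1983to89.MassGapOpenBoundaryConversion
import HarnessLib

/-!
# `Balaban1983to89.StrongCouplingOpenWindow` — the transfer-matrix gap of `SU(N)` lattice Yang–Mills, uniform in the
# spatial torus, inside the one-link Kantorovich–Rubinstein window (`SU(2)`: every Wilson `β_W ≤ 1/9`), pure kernel

**Observatory of the non-perturbative crossover; no mass-gap claim.**

Audit cell `pub-balaban`, build IR-4, seat `b2b-balaban-ir-sc-g5` (strong-coupling front, generation 5).  The four sibling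
modules of this seat (`StrongCouplingKPWindow`, `StrongCouplingDobrushinWindow`, `StrongCouplingTorusWindow`,
`StrongCouplingKernelWindow`) establish, hypothesis-free and in the kernel, the two strong-coupling currencies SC-a
(the DLR currency `DLRMassGapAt`) and SC-b (the volume-uniform torus clustering `CrossoverLedger.StrongCouplingFront`)
for `SU(2)`, `d = 4` up to Wilson `β_W = 1/9`, and for every `SU(N)` up to tree coupling `N/48`, from the one-link
Kantorovich–Rubinstein modulus `OneLinkKRModulus N R K` of the 't Hooft single-link law `ν_B(dg) ∝ exp(N Re tr(gB)) dg`
(decided in the kernel by the tree's Bakry–Émery theorem `SUNBakryEmery.haarPoincare_SU`, and sharpened for `SU(2)` by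
`oneLinkKRModulus_su2`).  The THIRD currency of the ledger (`ir/UNITS.md`), SC-c = the transfer-operator (Hamiltonian)
gap `Sufficient.TransferOperatorGap ρ β S m` of the Wilson transfer matrix on the spatial torus `(ℤ/(2S+1))³`, uniformly
in `S` (`CrossoverLedger.LatticeMassGap ρ β m`), had no entry.  This module supplies it, in the same window and from the
same one-link input, by running Dobrushin's uniqueness technique in Föllmer's Kantorovich–Rubinstein form on the FINITE
open slab `(ℤ/L)³ × {0, …, T}` and feeding the resulting time-clustering, uniform in `T`, into the tree's (ir-2)
conversion `transferOperatorGap_of_openBoundaryTimeClustering` (Perron–Frobenius–Krein–Rutman reading of the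
Lüscher–Schaefer open chain, module `MassGapOpenBoundaryConversion`).

## Contents

* §1 `weightSpec φ` / `weightMeasure φ`: the Gibbs specification and the (unique, finite-volume) Gibbs measure
  `(⊗ Haar).tilted φ` of a bounded measurable energy `φ` on a finite product of compact groups; `isSpecification_weightSpec`,
  `isGibbsMeasure_weightMeasure` (instances of the tree's tilted-specification theory `GibbsSpecificationTilted`).
* §2 `PlaqSystem V P`: an abstract finite plaquette system (each plaquette a word of four distinct links with a weight
  `coef ≥ 0`); `hol`, `energy`, links/plaquettes-through/neighbours, weighted degree `wdeg`, plaquette `closure`.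
* §3 `isKRContraction_su`: for the `SU(N)` Wilson weight `exp(−β coef (N − Re tr hol))` the one-link conditional law is a
  't Hooft law `ν_B` with `‖B‖_op ≤ (|β|/N)·wdeg`, and `OneLinkKRModulus N R K` gives Dobrushin's condition in the
  Kantorovich–Rubinstein (Frobenius-metric) form with row sums `≤ 3·Dg·(|β|/N)·K` when `wdeg ≤ Dg`.
* §4 DLR smoothing `specAvg`: bounded measurable local observables become link-Lipschitz after one application of the
  specification kernel on their support (tilt oscillation, Georgii Prop. 8.8), with support the plaquette closure.
* §5 `abs_integral_mul_sub_le_su`: Föllmer's covariance estimate (tree `abs_covariance_le_of_isKRContraction`) for two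
  bounded measurable local observables with separated closures, weighted by any `1`-Lipschitz exhaustion profile `ℓ`.
* §6 The open slab as a plaquette system: links `SlabLink L T` (spatial links of `T+1` slices, temporal links of `T`
  bonds), plaquettes `SlabPlaq L T` in the Lüscher–Schaefer book-keeping (spatial plaquettes of a bond's two slices with
  weight `½`, temporal plaquettes with weight `1`); `slab_energy_eq` (the energy is the sum of the exponents of
  `wilsonSliceKernel`), `wdeg_slab_le` (`wdeg ≤ 6`), link time and `card_closure_sliceLinks_le`.
* §7 `openExpectation_eq_integral_weightMeasure`: the tree's open-boundary expectation `openExpectation ρ β L T` IS the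
  expectation in `weightMeasure (energy of the slab)` (Fubini over the temporal links; item (ii) of the NOT-PROVED list
  of `MassGapOpenBoundary`), for every compact group and continuous matrix representation.
* §8 `openBoundaryTimeClustering_of_oneLinkKRModulus`: `OpenBoundaryTimeClustering (fundamentalRep (Fin N)) β L 𝒞 (krRate c)`
  for the class `𝒞` of bounded measurable slice observables, every `L ≥ 2`, with `c = 18(|β|/N)K < 1`, `6|β|/N ≤ R`,
  `OneLinkKRModulus N R K`, `krRate c = −log max(c, ½)`; hence `transferOperatorGap_of_oneLinkKRModulus` (every `S ≥ 1`),
  `latticeMassGap_of_oneLinkKRModulus`, and hypothesis-free: `latticeMassGap_SU` (`N ≥ 2`, `0 ≤ β < N/48`),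
  `su2_latticeMassGap_sharp`, `su2_latticeMassGap_ninth` (`SU(2)`, every Wilson `0 ≤ β_W ≤ 1/9`, tree coupling `β_W/2`,
  rate `krRate (18 β_W K₂(β_W))`, `= 0.01727…` at `β_W = 1/9`), `su2_latticeMassGap_at_ninth`.

## What is NOT claimed

Nothing about `β_W > 1/9`, the crossover, scaling or the continuum; no statement of the manuscripts under audit
(Bałaban, CMP 1983–89) is used or adjudicated here; the rate `krRate c` is the Dobrushin rate of the method, not a
physical mass.  The conversion to `TransferOperatorGap` is the tree's theorem and inherits its conventions (tree coupling
`β`, weight `exp(−β(N − Re tr U_p))` per plaquette; `β_W = 2β` for `SU(2)`; spatial torus side `2S+1 ≥ 3`).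

## Sources (method; every statement below is PROVED from Mathlib and tree theorems, the tags record whose method it is)

Dobrushin's uniqueness theorem in the Kantorovich–Rubinstein form and its covariance estimate: H. Föllmer, *Random
fields and diffusion processes*, École d'été de Saint-Flour XV–XVII (1985–87), LNM 1362, Thm. (2.13) and Remark (2.17)
(held text `albeverio2012-mathematical-physics-at-saint-flour`, pp. 86–87); H.-O. Georgii, *Gibbs Measures and Phase
Transitions*, 2nd ed. (2011), Prop. 8.8, Thm. 8.7, eq. (8.20).  The one-link 't Hooft law and the `SU(N)` window:
H. Shen, R. Zhu, X. Zhu, CMP 400 (2023) (arXiv:2204.12737), §1 (pp. 2–8) and §4 (pp. 17–30) of the arXiv v1 PDF (chunks 5–6 of the held TeX text) — METHOD only.  The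
open chain / transfer matrix of Wilson's action: M. Lüscher, S. Schaefer, JHEP 07 (2011) 036 (arXiv:1105.4749), §2.4
(weights `w(p)`: `½` on the boundary spatial plaquettes) and §2.5 (quantum-mechanical representation `Z = (Ω, 𝕋^{T/a} Ω)`); I. Montvay,
G. Münster, *Quantum Fields on a Lattice* (1994), §3.2.6, eq. (3.140).
-/

noncomputable section

open MeasureTheory Filter Topology ProbabilityTheory Function Finset
open scoped NNReal
open Literature.Probability.LatticeModels
open Literature.Probability.LatticeModels.DobrushinMetric
open Literature.MathematicalPhysics.QuantumLattice (fundamentalRep fundamentalLatticeRep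
  fundamentalRep_apply continuous_fundamentalRep fundamentalRep_injective fundamentalRep_mem_unitaryGroup)

namespace Literature.MathematicalPhysics.QuantumFieldTheory.Balaban1983to89.StrongCouplingOpenWindow

open Literature.MathematicalPhysics.QuantumFieldTheory
open Literature.MathematicalPhysics.QuantumFieldTheory.Balaban1983to89.StrongCouplingDobrushinWindow
open Literature.MathematicalPhysics.QuantumFieldTheory.Balaban1983to89.StrongCouplingTorusWindow
open Literature.MathematicalPhysics.QuantumFieldTheory.Balaban1983to89.StrongCouplingKernelWindow

/-! ## §1 The weight specification of a bounded energy on a finite product of Haar measures -/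

section WeightSpec

variable {V : Type*} [Fintype V] [DecidableEq V] {G : Type*} [Group G] [TopologicalSpace G]
  [IsTopologicalGroup G] [CompactSpace G] [MeasurableSpace G] [BorelSpace G]

/-- The **weight specification** of an energy `φ` on the finite link set `V`: in the volume `Λ` with boundary condition
`η` it is `Haar^{⊗Λ}(dζ) e^{φ(ζ η_{Λᶜ})}/Z` pushed to configurations (Georgii 2011, Def. 2.9: the Gibbsian
specification of a finite-volume Hamiltonian with a priori measure Haar). [cite: Georgii2011, Def. 2.9] -/
def weightSpec (φ : (V → G) → ℝ) : Specification V G :=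
  fun Λ η => ((Measure.pi fun _ : ↥Λ => haarProbability G).map (glueWith Λ · η)).tilted φ

/-- The **weight measure** `Haar^{⊗V}.tilted φ = Z⁻¹ e^{φ} ∏_v dU_v` of the energy `φ`. [cite: Georgii2011, Def. 2.9] -/
def weightMeasure (φ : (V → G) → ℝ) : Measure (V → G) :=
  (Measure.pi fun _ : V => haarProbability G).tilted φ

/-- The weight specification of a bounded measurable energy is a specification (Georgii 2011, Def. 2.9 with Def. 1.23;
the tree's `isSpecification_tilted_map_glueWith_pi` with a volume-independent energy). [cite: Georgii2011, Def. 2.9] -/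
theorem isSpecification_weightSpec [SecondCountableTopology G] [MeasurableSingletonClass G] {φ : (V → G) → ℝ}
    (hφm : Measurable φ) (hφb : ∃ C, ∀ σ, |φ σ| ≤ C) : IsSpecification (weightSpec (V := V) (G := G) φ) := by
  haveI : NeZero (haarProbability G) := ⟨IsProbabilityMeasure.ne_zero _⟩
  exact isSpecification_tilted_map_glueWith_pi (V := V) (S := G) (haarProbability G)
    (φ := fun _ => φ) (fun _ => hφm) (fun _ => hφb) (fun _ _ _ σ σ' _ => by simp)

omit [Fintype V] in
/-- **The one-link conditional law of a weight specification is a tilted Haar measure**: the law of `U_e` under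
`γ_{e}(· | ω)` is `Z⁻¹ e^{φ(ω^{e ← g})} dg` (Seiler LNP 159 Ch. 2; the tree's `siteLaw_torusWeightSpec_eq_tilted_haar`
for a general finite link set). [cite: SeilerLNP1982, Ch. 2] -/
theorem siteLaw_weightSpec_eq_tilted [SecondCountableTopology G] {φ : (V → G) → ℝ} (hφm : Measurable φ) (e : V)
    (ω : V → G) :
    siteLaw (weightSpec φ) e ω = (haarProbability G).tilted fun g => φ (Function.update ω e g) := by
  have h1 : weightSpec φ {e} ω =
      ((Measure.pi fun _ : ↥({e} : Finset V) => haarProbability G).tilted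
        (φ ∘ fun ζ => glueWith {e} ζ ω)).map (fun ζ => glueWith {e} ζ ω) := by
    unfold weightSpec
    rw [map_tilted_comp _ (measurable_glueWith _ ω) hφm]
  have hgl : (fun ζ : ↥({e} : Finset V) → G => glueWith {e} ζ ω) =
      Function.update ω e ∘ fun ζ => ζ ⟨e, Finset.mem_singleton_self e⟩ := by
    funext ζ z
    by_cases hz : z = e
    · subst hz
      simp
    · rw [Function.comp_apply, Function.update_of_ne hz,
        glueWith_apply_not_mem _ _ _ (by simpa using hz)]
  have hev : (Measure.pi fun _ : ↥({e} : Finset V) => haarProbability G).map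
      (fun ζ => ζ ⟨e, Finset.mem_singleton_self e⟩) = haarProbability G :=
    (MeasureTheory.measurePreserving_eval (fun _ : ↥({e} : Finset V) =>
      haarProbability G) ⟨e, Finset.mem_singleton_self e⟩).map_eq
  have hF' : Measurable fun g : G => φ (Function.update ω e g) := hφm.comp (measurable_update ω)
  have key := map_tilted_comp (Measure.pi fun _ : ↥({e} : Finset V) => haarProbability G)
    (measurable_pi_apply (⟨e, Finset.mem_singleton_self e⟩ : ↥({e} : Finset V))) hF'
  rw [hev] at key
  rw [siteLaw, h1, Measure.map_map (measurable_pi_apply e) (measurable_glueWith _ ω), hgl]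
  have hcomp : (φ ∘ Function.update ω e ∘ fun ζ : ↥({e} : Finset V) → G => ζ ⟨e, Finset.mem_singleton_self e⟩) =
      (fun g => φ (Function.update ω e g)) ∘
        fun ζ : ↥({e} : Finset V) → G => ζ ⟨e, Finset.mem_singleton_self e⟩ := rfl
  have hcomp' : ((fun σ : V → G => σ e) ∘ Function.update ω e ∘
      fun ζ : ↥({e} : Finset V) → G => ζ ⟨e, Finset.mem_singleton_self e⟩) =
      fun ζ : ↥({e} : Finset V) → G => ζ ⟨e, Finset.mem_singleton_self e⟩ := by
    funext ζ; simp
  rw [hcomp, hcomp']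
  exact key

omit [DecidableEq V] in
/-- Gluing on the full volume pushes `Haar^{⊗univ}` to `Haar^{⊗V}`. [folklore] -/
theorem map_glueWith_univ_pi_eq (η : V → G) :
    (Measure.pi fun _ : ↥(Finset.univ : Finset V) => haarProbability G).map (glueWith Finset.univ · η) =
      Measure.pi fun _ : V => haarProbability G := by
  let f : ↥(Finset.univ : Finset V) ≃ V :=
    ⟨fun x => x.1, fun e => ⟨e, Finset.mem_univ e⟩, fun x => by simp, fun e => rfl⟩
  have hglue : (fun ζ : ↥(Finset.univ : Finset V) → G => glueWith Finset.univ ζ η) =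
      MeasurableEquiv.piCongrLeft (fun _ : V => G) f := by
    funext ζ e
    rw [glueWith_apply_mem _ _ _ (Finset.mem_univ e), MeasurableEquiv.coe_piCongrLeft,
      Equiv.piCongrLeft_apply_eq_cast]
    rfl
  rw [hglue]
  exact (measurePreserving_piCongrLeft (fun _ : V => haarProbability G) f).map_eq

omit [DecidableEq V] in
/-- **In the full volume the weight specification is the weight measure**, whatever the boundary condition.
[cite: Georgii2011, Def. 2.9] -/
theorem weightSpec_univ (φ : (V → G) → ℝ) (η : V → G) : weightSpec φ Finset.univ η = weightMeasure φ := by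
  rw [weightSpec, map_glueWith_univ_pi_eq, weightMeasure]

/-- **DLR equations for the weight measure**: it is a Gibbs measure of the weight specification (Georgii 2011,
Def. 1.23 with Remark (1.24) for a finite system). [cite: Georgii2011, Def. 1.23 / Rem. 1.24] -/
theorem isGibbsMeasure_weightMeasure [SecondCountableTopology G] [MeasurableSingletonClass G] {φ : (V → G) → ℝ}
    (hφm : Measurable φ) (hφb : ∃ C, ∀ σ, |φ σ| ≤ C) :
    IsGibbsMeasure (weightSpec φ) (weightMeasure (V := V) (G := G) φ) := by
  classical
  have hγ := isSpecification_weightSpec (V := V) (G := G) hφm hφb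
  obtain ⟨η⟩ : Nonempty (V → G) := ⟨fun _ => 1⟩
  rw [← weightSpec_univ φ η]
  refine ⟨hγ.isProbability _ _, fun Λ A hA => ?_⟩
  exact hγ.consistent (Finset.subset_univ Λ) η A hA

omit [Fintype V] [DecidableEq V] in
/-- **The smoothing by a weight specification as a tilted product-Haar integral**:
`γ_Λ f (η) = ∫ f(ζ η_{Λᶜ}) Haar^{⊗Λ}.tilted(φ(· η_{Λᶜ}))(dζ)`. [cite: Georgii2011, Def. 2.9] -/
theorem specAvg_weightSpec_eq {φ : (V → G) → ℝ} (hφm : Measurable φ) (Λ : Finset V) {f : (V → G) → ℝ}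
    (hfm : Measurable f) (η : V → G) :
    specAvg (weightSpec φ) Λ f η =
      ∫ ζ, f (glueWith Λ ζ η) ∂((Measure.pi fun _ : ↥Λ => haarProbability G).tilted fun ζ => φ (glueWith Λ ζ η)) := by
  unfold specAvg weightSpec
  rw [← map_tilted_comp _ (measurable_glueWith Λ η) hφm,
    integral_map (measurable_glueWith Λ η).aemeasurable hfm.aestronglyMeasurable]
  rfl

end WeightSpec

/-- A continuous function on a compact space is bounded. [folklore] -/
theorem exists_abs_le_of_continuous {X : Type*} [TopologicalSpace X] [CompactSpace X] {φ : X → ℝ}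
    (hφ : Continuous φ) : ∃ C, ∀ σ, |φ σ| ≤ C := by
  obtain ⟨C, hC⟩ := isCompact_univ.exists_bound_of_continuousOn hφ.continuousOn
  exact ⟨C, fun σ => by simpa [Real.norm_eq_abs] using hC σ (Set.mem_univ σ)⟩

/-! ## §2 Finite plaquette systems: holonomies, staples, the action is affine in each link -/

/-- A **finite plaquette system**: a set `P` of plaquettes each reading four DISTINCT links of `V` (in the cyclic order of a
lattice plaquette `U₁ U₂ U₃⁻¹ U₄⁻¹`) with a non-negative weight `coef` (Wilson: `1`; Lüscher–Schaefer boundary slices: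
`½`). [folklore] -/
structure PlaqSystem (V P : Type*) where
  /-- the four links of a plaquette, in holonomy order -/
  lk : P → Fin 4 → V
  /-- the four links of a plaquette are distinct -/
  lk_injective : ∀ q, Function.Injective (lk q)
  /-- the weight of a plaquette in the energy -/
  coef : P → ℝ
  /-- weights are non-negative -/
  coef_nonneg : ∀ q, 0 ≤ coef q

namespace PlaqSystem

section Algebra

variable {V P : Type*} (S : PlaqSystem V P) {G : Type*} [Group G]

/-- The **holonomy** `U_q = U(l₀) U(l₁) U(l₂)⁻¹ U(l₃)⁻¹` of the plaquette `q`. [folklore] -/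
def hol (U : V → G) (q : P) : G :=
  U (S.lk q 0) * U (S.lk q 1) * (U (S.lk q 2))⁻¹ * (U (S.lk q 3))⁻¹

/-- Configurations agreeing on the links of `q` have the same holonomy around `q`. [folklore] -/
theorem hol_congr {U U' : V → G} {q : P} (h : ∀ k, U (S.lk q k) = U' (S.lk q k)) :
    S.hol U q = S.hol U' q := by
  simp only [hol, h]

/-- The positions of the three staple letters of a plaquette read at position `k`. [folklore] -/
def stapleIdx : Fin 4 → Fin 3 → Fin 4 := ![![1, 2, 3], ![2, 3, 0], ![1, 0, 3], ![2, 1, 0]]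

/-- The sign pattern (`a b⁻¹ c⁻¹` or `a⁻¹ b⁻¹ c`) of the staple at position `k`. [folklore] -/
def stapleSign : Fin 4 → Bool := ![true, false, false, true]

/-- A staple letter position differs from the position it is read at. [folklore] -/
theorem stapleIdx_ne : ∀ (k : Fin 4) (j : Fin 3), stapleIdx k j ≠ k := by decide

/-- The **staple** of the plaquette `q` at position `k` in the configuration `ω`: the ordered product of the other three
link variables for which `Re tr ρ(U_q(ω^{l_k ← g})) = Re tr(ρ(g) ρ(staple))` (`re_trace_hol_update`; Shen–Zhu–Zhu CMP 400
(2023) §4.1). [folklore] -/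
def staple (q : P) (k : Fin 4) (ω : V → G) : G :=
  stapleWord (stapleSign k) (ω (S.lk q (stapleIdx k 0))) (ω (S.lk q (stapleIdx k 1))) (ω (S.lk q (stapleIdx k 2)))

variable {N : ℕ} (ρ : G →* Matrix (Fin N) (Fin N) ℂ)

/-- **The plaquette action is affine in each link**: `Re tr ρ(U_q(ω^{l_k ← g})) = Re tr(ρ(g) ρ(staple_q^k(ω)))` for a
unitary representation (Shen–Zhu–Zhu CMP 400 (2023) §4.1). [folklore] -/
theorem re_trace_hol_update [DecidableEq V] (hρu : ∀ g, ρ g ∈ Matrix.unitaryGroup (Fin N) ℂ) (q : P) (k : Fin 4)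
    (ω : V → G) (g : G) :
    (ρ (S.hol (Function.update ω (S.lk q k) g) q)).trace.re = (ρ g * ρ (S.staple q k ω)).trace.re := by
  have hne : ∀ {i j : Fin 4}, i ≠ j → S.lk q i ≠ S.lk q j := fun h => (S.lk_injective q).ne h
  rw [← map_mul]
  unfold hol staple stapleWord stapleIdx stapleSign
  fin_cases k
  · simp only [Fin.zero_eta, Fin.isValue, Function.update_self, Matrix.cons_val_zero, Matrix.cons_val_one,
      Matrix.cons_val, if_true]
    rw [Function.update_of_ne (hne (by decide)), Function.update_of_ne (hne (by decide)),
      Function.update_of_ne (hne (by decide))]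
    congr 3
    group
  · simp only [Fin.mk_one, Fin.isValue, Function.update_self, Matrix.cons_val_zero, Matrix.cons_val_one,
      Matrix.cons_val, Bool.false_eq_true, if_false]
    rw [Function.update_of_ne (hne (by decide)), Function.update_of_ne (hne (by decide)),
      Function.update_of_ne (hne (by decide))]
    rw [show ω (S.lk q 0) * g * (ω (S.lk q 2))⁻¹ * (ω (S.lk q 3))⁻¹ =
      ω (S.lk q 0) * (g * ((ω (S.lk q 2))⁻¹ * (ω (S.lk q 3))⁻¹)) by group, re_trace_map_mul_comm ρ]
    congr 3
    group
  · simp only [Fin.reduceFinMk, Fin.isValue, Function.update_self, Matrix.cons_val_zero, Matrix.cons_val_one,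
      Matrix.cons_val, Bool.false_eq_true, if_false]
    rw [Function.update_of_ne (hne (by decide)), Function.update_of_ne (hne (by decide)),
      Function.update_of_ne (hne (by decide))]
    rw [← re_trace_map_inv ρ hρu]
    rw [show (ω (S.lk q 0) * ω (S.lk q 1) * g⁻¹ * (ω (S.lk q 3))⁻¹)⁻¹ =
      ω (S.lk q 3) * (g * ((ω (S.lk q 1))⁻¹ * (ω (S.lk q 0))⁻¹)) by group, re_trace_map_mul_comm ρ]
    congr 3
    group
  · simp only [Fin.reduceFinMk, Fin.isValue, Function.update_self, Matrix.cons_val_zero, Matrix.cons_val_one,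
      Matrix.cons_val, if_true]
    rw [Function.update_of_ne (hne (by decide)), Function.update_of_ne (hne (by decide)),
      Function.update_of_ne (hne (by decide))]
    rw [← re_trace_map_inv ρ hρu]
    congr 3
    group

end Algebra

/-! ### Links through a vertex of the system, weighted degree, influence counts -/

section Combinatorics

variable {V P : Type*} [Fintype P] [DecidableEq V] (S : PlaqSystem V P)

/-- The four links of a plaquette, as a finite set. [folklore] -/
def links (q : P) : Finset V := Finset.univ.image (S.lk q)

/-- The plaquettes through a link. [folklore] -/
def pthru (v : V) : Finset P := Finset.univ.filter fun q => v ∈ S.links q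

/-- The (plaquette, position) pairs at which a link is read. [folklore] -/
def thru (v : V) : Finset (P × Fin 4) := Finset.univ.filter fun qk => S.lk qk.1 qk.2 = v

/-- The **plaquette neighbours** of a link: the other links of the plaquettes through it. [folklore] -/
def nbr (v : V) : Finset V := ((S.pthru v).biUnion S.links).erase v

/-- The **weighted degree** `∑_{q ∋ v} coef q` of a link. [folklore] -/
def wdeg (v : V) : ℝ := ∑ q ∈ S.pthru v, S.coef q

/-- The **weighted influence count** `n(v, y) = ∑_{(q,k) : l_k(q) = v} coef q · #{j : staple letter j is y}`. [folklore] -/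
def infl (v y : V) : ℝ :=
  ∑ qk ∈ S.thru v, S.coef qk.1 * ∑ j : Fin 3, if S.lk qk.1 (stapleIdx qk.2 j) = y then (1 : ℝ) else 0

omit [Fintype P] in
/-- Membership in the link set of a plaquette. [folklore] -/
theorem mem_links {q : P} {v : V} : v ∈ S.links q ↔ ∃ k, S.lk q k = v := by
  simp [links]

omit [Fintype P] in
/-- Each letter of a plaquette word is one of its links. [folklore] -/
theorem lk_mem_links (q : P) (k : Fin 4) : S.lk q k ∈ S.links q := (S.mem_links).2 ⟨k, rfl⟩

/-- Plaquettes through a link. [folklore] -/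
theorem mem_pthru {q : P} {v : V} : q ∈ S.pthru v ↔ v ∈ S.links q := by
  simp [pthru]

/-- Plaquette letters reading a given link. [folklore] -/
theorem mem_thru {qk : P × Fin 4} {v : V} : qk ∈ S.thru v ↔ S.lk qk.1 qk.2 = v := by
  simp [thru]

/-- A link is not its own plaquette neighbour. [folklore] -/
theorem not_mem_nbr (v : V) : v ∉ S.nbr v := Finset.notMem_erase v _

/-- A staple letter of a pair through `v` is a plaquette neighbour of `v`. [folklore] -/
theorem lk_stapleIdx_mem_nbr {qk : P × Fin 4} {v : V} (h : qk ∈ S.thru v) (j : Fin 3) :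
    S.lk qk.1 (stapleIdx qk.2 j) ∈ S.nbr v := by
  rw [S.mem_thru] at h
  refine Finset.mem_erase.2 ⟨?_, Finset.mem_biUnion.2 ⟨qk.1, (S.mem_pthru).2 ?_, S.lk_mem_links _ _⟩⟩
  · rw [← h]
    exact (S.lk_injective qk.1).ne (stapleIdx_ne _ _)
  · rw [← h]; exact S.lk_mem_links _ _

/-- Sums over the pairs through `v` of a function of the plaquette are sums over the plaquettes through `v` (a plaquette
reads a link at most once). [folklore] -/
theorem sum_thru_eq_sum_pthru (F : P → ℝ) (v : V) : ∑ qk ∈ S.thru v, F qk.1 = ∑ q ∈ S.pthru v, F q := by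
  rw [thru, Finset.sum_filter, Fintype.sum_prod_type, pthru, Finset.sum_filter]
  refine Finset.sum_congr rfl fun q _ => ?_
  by_cases hq : v ∈ S.links q
  · obtain ⟨k₀, hk₀⟩ := (S.mem_links).1 hq
    rw [if_pos hq, Finset.sum_eq_single k₀]
    · rw [if_pos hk₀]
    · intro k _ hk
      rw [if_neg]
      intro hk'
      exact hk ((S.lk_injective q) (hk'.trans hk₀.symm))
    · intro h; exact absurd (Finset.mem_univ k₀) h
  · rw [if_neg hq]
    refine Finset.sum_eq_zero fun k _ => ?_
    rw [if_neg]
    intro hk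
    exact hq ((S.mem_links).2 ⟨k, hk⟩)

/-- The weighted degree is non-negative. [folklore] -/
theorem wdeg_nonneg (v : V) : 0 ≤ S.wdeg v := Finset.sum_nonneg fun q _ => S.coef_nonneg q

/-- The influence coefficients are non-negative. [folklore] -/
theorem infl_nonneg (v y : V) : 0 ≤ S.infl v y :=
  Finset.sum_nonneg fun qk _ => mul_nonneg (S.coef_nonneg _)
    (Finset.sum_nonneg fun j _ => by split_ifs <;> norm_num)

/-- **Row sums of the influence count**: `∑_{y ∈ nbr v} n(v, y) ≤ 3 · wdeg v`. [folklore] -/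
theorem sum_infl_le (v : V) : ∑ y ∈ S.nbr v, S.infl v y ≤ 3 * S.wdeg v := by
  unfold infl
  rw [Finset.sum_comm]
  calc ∑ qk ∈ S.thru v, ∑ y ∈ S.nbr v, S.coef qk.1 *
        ∑ j : Fin 3, (if S.lk qk.1 (stapleIdx qk.2 j) = y then (1 : ℝ) else 0)
      ≤ ∑ qk ∈ S.thru v, S.coef qk.1 * 3 := by
        refine Finset.sum_le_sum fun qk _ => ?_
        rw [← Finset.mul_sum]
        refine mul_le_mul_of_nonneg_left ?_ (S.coef_nonneg _)
        rw [Finset.sum_comm]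
        calc ∑ j : Fin 3, ∑ y ∈ S.nbr v, (if S.lk qk.1 (stapleIdx qk.2 j) = y then (1 : ℝ) else 0)
            ≤ ∑ _j : Fin 3, (1 : ℝ) := Finset.sum_le_sum fun j _ => by
              rw [Finset.sum_ite_eq]
              split_ifs <;> norm_num
          _ = 3 := by simp
    _ = 3 * S.wdeg v := by rw [← Finset.sum_mul, S.sum_thru_eq_sum_pthru, wdeg, mul_comm]

end Combinatorics

/-! ## §3 `SU(N)`: the one-link law in 't Hooft form and Dobrushin's condition from the one-link modulus -/

section SUN

variable {V P : Type*} [Fintype P] [DecidableEq V] (S : PlaqSystem V P) {N : ℕ}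

omit [Fintype P] [DecidableEq V] in
/-- The staples are `1`-Lipschitz in each of their three letters for the Frobenius distance. [folklore] -/
theorem suFrobDist_staple_le (q : P) (k : Fin 4) (ω η : V → Matrix.specialUnitaryGroup (Fin N) ℂ) :
    suFrobDist (S.staple q k ω) (S.staple q k η) ≤
      ∑ j : Fin 3, suFrobDist (ω (S.lk q (stapleIdx k j))) (η (S.lk q (stapleIdx k j))) := by
  rw [staple, staple, Fin.sum_univ_three]
  exact suFrobDist_stapleWord_le _ _ _ _ _ _ _

/-- The **weighted staple sum** `S_ω(v) = ∑_{(q,k) : l_k(q) = v} coef q · staple_q^k(ω) ∈ M_N(ℂ)`. [folklore] -/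
def stapleSum (v : V) (ω : V → Matrix.specialUnitaryGroup (Fin N) ℂ) : Matrix (Fin N) (Fin N) ℂ :=
  ∑ qk ∈ S.thru v, ((S.coef qk.1 : ℝ) : ℂ) •
    ((S.staple qk.1 qk.2 ω : Matrix.specialUnitaryGroup (Fin N) ℂ) : Matrix (Fin N) (Fin N) ℂ)

/-- `‖S_ω(v)‖_op ≤ wdeg v` (each staple is unitary). [folklore] -/
theorem matrixOpNorm_stapleSum_le [Nonempty (Fin N)] (v : V) (ω : V → Matrix.specialUnitaryGroup (Fin N) ℂ) :
    matrixOpNorm (S.stapleSum v ω) ≤ S.wdeg v := by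
  refine (matrixOpNorm_sum_le _ _).trans ?_
  have h : ∀ qk ∈ S.thru v, matrixOpNorm (((S.coef qk.1 : ℝ) : ℂ) •
      ((S.staple qk.1 qk.2 ω : Matrix.specialUnitaryGroup (Fin N) ℂ) : Matrix (Fin N) (Fin N) ℂ)) = S.coef qk.1 := by
    intro qk _
    rw [matrixOpNorm_smul, matrixOpNorm_of_mem_unitaryGroup (su_mem_unitaryGroup _), mul_one, Complex.norm_real,
      Real.norm_eq_abs, abs_of_nonneg (S.coef_nonneg _)]
  rw [Finset.sum_congr rfl h, S.sum_thru_eq_sum_pthru]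
  rfl

/-- **Lipschitz dependence of the staple sum on one link**: if `ω = η` off `y`, then
`‖S_ω(v) − S_η(v)‖_F ≤ n(v, y) ‖ω_y − η_y‖_F`. [folklore] -/
theorem frobNorm_stapleSum_sub_le (v y : V) {ω η : V → Matrix.specialUnitaryGroup (Fin N) ℂ}
    (hωη : ∀ z, z ≠ y → ω z = η z) :
    frobNorm (S.stapleSum v ω - S.stapleSum v η) ≤ S.infl v y * suFrobDist (ω y) (η y) := by
  rw [stapleSum, stapleSum, ← Finset.sum_sub_distrib]
  refine (frobNorm_sum_le _ _).trans ?_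
  rw [infl, Finset.sum_mul]
  refine Finset.sum_le_sum fun qk _ => ?_
  rw [← smul_sub, frobNorm_smul, Complex.norm_real, Real.norm_eq_abs, abs_of_nonneg (S.coef_nonneg _), mul_assoc]
  refine mul_le_mul_of_nonneg_left ?_ (S.coef_nonneg _)
  refine (S.suFrobDist_staple_le qk.1 qk.2 ω η).trans ?_
  rw [Finset.sum_mul]
  refine Finset.sum_le_sum fun j _ => ?_
  by_cases hj : S.lk qk.1 (stapleIdx qk.2 j) = y
  · rw [hj, if_pos rfl, one_mul]
  · rw [hωη _ hj, suFrobDist_self, if_neg hj, zero_mul]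

variable (N) in
/-- The **log of the Wilson plaquette weight of `SU(N)`** at tree coupling `β`: `w_β(h) = −β (N − Re tr h)`
(`= log (wilsonPlaqWeight N β h)`). [folklore] -/
def suWeight (β : ℝ) (h : Matrix.specialUnitaryGroup (Fin N) ℂ) : ℝ :=
  -(β * ((N : ℝ) - (h : Matrix (Fin N) (Fin N) ℂ).trace.re))

/-- The `SU(N)` Wilson log-weight is continuous. [folklore] -/
theorem continuous_suWeight (β : ℝ) : Continuous (suWeight N β) := by
  unfold suWeight
  have h : Continuous fun g : Matrix.specialUnitaryGroup (Fin N) ℂ => (g : Matrix (Fin N) (Fin N) ℂ).trace.re :=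
    Complex.continuous_re.comp (continuous_subtype_val.matrix_trace)
  fun_prop

/-- The **energy** `E_w(U) = ∑_q coef q · w(U_q)` of the plaquette system with plaquette log-weight `w`. [folklore] -/
def energy {G : Type*} [Group G] (w : G → ℝ) (U : V → G) : ℝ := ∑ q, S.coef q * w (S.hol U q)

omit [DecidableEq V] in
/-- The energy is continuous for a continuous log-weight on a topological group. [folklore] -/
theorem continuous_energy {G : Type*} [Group G] [TopologicalSpace G] [IsTopologicalGroup G] {w : G → ℝ}
    (hw : Continuous w) : Continuous (S.energy w) := by
  unfold energy hol
  refine continuous_finsetSum _ fun q _ => continuous_const.mul (hw.comp ?_)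
  fun_prop

omit [DecidableEq V] in
/-- The energy is measurable (finite link set, second-countable group). [folklore] -/
theorem measurable_energy [Fintype V] {G : Type*} [Group G] [TopologicalSpace G] [IsTopologicalGroup G]
    [MeasurableSpace G] [BorelSpace G] [SecondCountableTopology G] {w : G → ℝ} (hw : Continuous w) :
    Measurable (S.energy w) :=
  (S.continuous_energy hw).measurable

/-- The **link field** `B_ω(v) = (β/N) S_ω(v)` ('t Hooft coupling `β/N`). [folklore] -/
def field (β : ℝ) (v : V) (ω : V → Matrix.specialUnitaryGroup (Fin N) ℂ) : Matrix (Fin N) (Fin N) ℂ :=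
  ((β / N : ℝ) : ℂ) • S.stapleSum v ω

/-- `‖B_ω(v)‖_op ≤ (|β|/N) · wdeg v`. [folklore] -/
theorem matrixOpNorm_field_le (hN : 1 ≤ N) (β : ℝ) (v : V) (ω : V → Matrix.specialUnitaryGroup (Fin N) ℂ) :
    matrixOpNorm (S.field β v ω) ≤ |β| / N * S.wdeg v := by
  haveI : Nonempty (Fin N) := ⟨⟨0, hN⟩⟩
  rw [field, matrixOpNorm_smul, Complex.norm_real, Real.norm_eq_abs, abs_div, Nat.abs_cast]
  exact mul_le_mul_of_nonneg_left (S.matrixOpNorm_stapleSum_le v ω) (by positivity)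

/-- `‖B_ω(v) − B_η(v)‖_F ≤ (|β|/N) n(v, y) ‖ω_y − η_y‖_F` when `ω = η` off `y`. [folklore] -/
theorem frobNorm_field_sub_le (β : ℝ) (v y : V) {ω η : V → Matrix.specialUnitaryGroup (Fin N) ℂ}
    (hωη : ∀ z, z ≠ y → ω z = η z) :
    frobNorm (S.field β v ω - S.field β v η) ≤ |β| / N * S.infl v y * suFrobDist (ω y) (η y) := by
  rw [field, field, ← smul_sub, frobNorm_smul, Complex.norm_real, Real.norm_eq_abs, abs_div, Nat.abs_cast,
    mul_assoc]
  exact mul_le_mul_of_nonneg_left (S.frobNorm_stapleSum_sub_le v y hωη) (by positivity)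

/-- The field at `v` depends on the configuration only through the plaquette neighbours of `v`. [folklore] -/
theorem field_congr (β : ℝ) (v : V) {η η' : V → Matrix.specialUnitaryGroup (Fin N) ℂ}
    (h : ∀ z ∈ S.nbr v, η z = η' z) : S.field β v η = S.field β v η' := by
  unfold field stapleSum
  congr 1
  refine Finset.sum_congr rfl fun qk hqk => ?_
  congr 2
  unfold staple
  rw [h _ (S.lk_stapleIdx_mem_nbr hqk 0), h _ (S.lk_stapleIdx_mem_nbr hqk 1), h _ (S.lk_stapleIdx_mem_nbr hqk 2)]

/-- The part of the energy at a link not read by the link: plaquettes away from `v` and the constant `−β N coef` of the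
plaquettes through `v`. [folklore] -/
def offEnergy (β : ℝ) (v : V) (ω : V → Matrix.specialUnitaryGroup (Fin N) ℂ) : ℝ :=
  ∑ q, S.coef q * (if v ∈ S.links q then -(β * N) else suWeight N β (S.hol ω q))

/-- **The energy at a link in 't Hooft form**: `E(ω^{v←g}) = E_off(ω) + N Re tr(g B_ω(v))`. [folklore] -/
theorem energy_update_eq (hN : 1 ≤ N) (β : ℝ) (v : V) (ω : V → Matrix.specialUnitaryGroup (Fin N) ℂ)
    (g : Matrix.specialUnitaryGroup (Fin N) ℂ) :
    S.energy (suWeight N β) (Function.update ω v g) =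
      S.offEnergy β v ω + (N : ℝ) * ((g : Matrix (Fin N) (Fin N) ℂ) * S.field β v ω).trace.re := by
  have hN0 : (N : ℝ) ≠ 0 := by exact_mod_cast (show N ≠ 0 by omega)
  -- per plaquette
  have hq : ∀ q : P, suWeight N β (S.hol (Function.update ω v g) q) =
      (if v ∈ S.links q then -(β * N) else suWeight N β (S.hol ω q)) +
        ∑ k : Fin 4, (if S.lk q k = v then β * ((g : Matrix (Fin N) (Fin N) ℂ) *
          ((S.staple q k ω : Matrix.specialUnitaryGroup (Fin N) ℂ) : Matrix (Fin N) (Fin N) ℂ)).trace.re else 0) := by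
    intro q
    by_cases hv : v ∈ S.links q
    · obtain ⟨k₀, hk₀⟩ := (S.mem_links).1 hv
      rw [if_pos hv, Finset.sum_eq_single k₀]
      · rw [if_pos hk₀, ← hk₀]
        have h := S.re_trace_hol_update (fundamentalRep (Fin N)) fundamentalRep_mem_unitaryGroup q k₀ ω g
        simp only [fundamentalRep_apply] at h
        rw [suWeight, h]
        ring
      · intro k _ hk
        rw [if_neg]
        intro hk'
        exact hk ((S.lk_injective q) (hk'.trans hk₀.symm))
      · intro h; exact absurd (Finset.mem_univ k₀) h
    · rw [if_neg hv]
      have h0 : ∑ k : Fin 4, (if S.lk q k = v then β * ((g : Matrix (Fin N) (Fin N) ℂ) *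
          ((S.staple q k ω : Matrix.specialUnitaryGroup (Fin N) ℂ) : Matrix (Fin N) (Fin N) ℂ)).trace.re else 0) = 0 :=
        Finset.sum_eq_zero fun k _ => by
          rw [if_neg]
          intro hk
          exact hv ((S.mem_links).2 ⟨k, hk⟩)
      rw [h0, add_zero, S.hol_congr (U := Function.update ω v g) (U' := ω)]
      intro k
      rw [Function.update_of_ne]
      intro hk
      exact hv ((S.mem_links).2 ⟨k, hk⟩)
  unfold energy
  simp_rw [hq, mul_add, Finset.sum_add_distrib]
  rw [offEnergy]
  congr 1
  -- the staple sum in 't Hooft form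
  have hsum : ∑ q, S.coef q * ∑ k : Fin 4, (if S.lk q k = v then β * ((g : Matrix (Fin N) (Fin N) ℂ) *
      ((S.staple q k ω : Matrix.specialUnitaryGroup (Fin N) ℂ) : Matrix (Fin N) (Fin N) ℂ)).trace.re else 0) =
      ∑ qk ∈ S.thru v, S.coef qk.1 * (β * ((g : Matrix (Fin N) (Fin N) ℂ) *
        ((S.staple qk.1 qk.2 ω : Matrix.specialUnitaryGroup (Fin N) ℂ) : Matrix (Fin N) (Fin N) ℂ)).trace.re) := by
    rw [thru, Finset.sum_filter, Fintype.sum_prod_type]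
    refine Finset.sum_congr rfl fun q _ => ?_
    rw [Finset.mul_sum]
    refine Finset.sum_congr rfl fun k _ => ?_
    split_ifs <;> simp
  rw [hsum, field, stapleSum, Matrix.mul_smul, Matrix.trace_smul, smul_eq_mul, Complex.re_ofReal_mul,
    Finset.mul_sum, Matrix.trace_sum, Complex.re_sum]
  rw [Finset.mul_sum, Finset.mul_sum]
  refine Finset.sum_congr rfl fun qk _ => ?_
  rw [Matrix.mul_smul, Matrix.trace_smul, smul_eq_mul, Complex.re_ofReal_mul]
  field_simp

/-- **The one-link conditional law of the plaquette-system energy in 't Hooft form**: the law of `U_v` under the weight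
specification of `E_{w_β}` with boundary condition `ω` is `ν_{B_ω(v)}(dg) ∝ exp(N Re tr(g B_ω(v))) dg` (Shen–Zhu–Zhu
CMP 400 (2023) (1.1)–(1.2) at one link). [cite: arXiv220412737, (1.1)–(1.2)] -/
theorem siteLaw_thooft [Fintype V] (hN : 1 ≤ N) (β : ℝ) (v : V) (ω : V → Matrix.specialUnitaryGroup (Fin N) ℂ) :
    siteLaw (weightSpec (S.energy (suWeight N β))) v ω =
      (haarProbability (Matrix.specialUnitaryGroup (Fin N) ℂ)).tilted
        fun g => (N : ℝ) * ((g : Matrix (Fin N) (Fin N) ℂ) * S.field β v ω).trace.re := by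
  haveI : SecondCountableTopology (Matrix (Fin N) (Fin N) ℂ) :=
    inferInstanceAs (SecondCountableTopology (Fin N → Fin N → ℂ))
  haveI : SecondCountableTopology (Matrix.specialUnitaryGroup (Fin N) ℂ) :=
    Topology.IsEmbedding.subtypeVal.secondCountableTopology
  rw [siteLaw_weightSpec_eq_tilted (S.measurable_energy (continuous_suWeight β)) v ω]
  have : (fun g : Matrix.specialUnitaryGroup (Fin N) ℂ => S.energy (suWeight N β) (Function.update ω v g)) =
      fun g : Matrix.specialUnitaryGroup (Fin N) ℂ =>
        S.offEnergy β v ω + (N : ℝ) * ((g : Matrix (Fin N) (Fin N) ℂ) * S.field β v ω).trace.re :=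
    funext (S.energy_update_eq hN β v ω)
  rw [this, tilted_const_add_eq]

/-- **The one-link modulus gives Dobrushin's condition for the plaquette system**: with `‖B_ω(v)‖_op ≤ (|β|/N) D ≤ R`
(weighted degree `≤ D`) and `‖B_ω − B_η‖_F ≤ (|β|/N) n(v,y) ‖ω_y − η_y‖_F`, the modulus `OneLinkKRModulus N R K` makes the
weight specification a Kantorovich–Rubinstein contraction for the Frobenius distance over the plaquette neighbours with
coefficients `C(v,y) = K (|β|/N) n(v,y)` (Shen–Zhu–Zhu CMP 400 (2023), the unnumbered remark p. 6 after Rem. 1.3 of arXiv:2204.12737; Föllmer 1988 Ch. I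
Remark (2.17)). [cite: arXiv220412737, unnumbered remark p. 6 (after Rem. 1.3; Dobrushin route)] [cite: Follmer1988, Ch. I Remark (2.17)] -/
theorem isKRContraction_su [Fintype V] (hN : 1 ≤ N) {β R K D : ℝ} (hK : 0 ≤ K) (hdeg : ∀ v, S.wdeg v ≤ D)
    (hR : |β| / N * D ≤ R) (hmod : OneLinkKRModulus N R K) :
    IsKRContraction (weightSpec (S.energy (suWeight N β))) suFrobDist S.nbr
      fun v y => K * (|β| / N) * S.infl v y := by
  refine ⟨S.not_mem_nbr, fun v y => mul_nonneg (by positivity) (S.infl_nonneg v y), fun v η η' h => ?_,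
    fun v y _ ω η hωη φ L' hφm hφb hL' hφL => ?_⟩
  · rw [S.siteLaw_thooft hN β v η, S.siteLaw_thooft hN β v η', S.field_congr β v h]
  rw [S.siteLaw_thooft hN β v ω, S.siteLaw_thooft hN β v η]
  have hBω := (S.matrixOpNorm_field_le hN β v ω).trans
    ((mul_le_mul_of_nonneg_left (hdeg v) (by positivity)).trans hR)
  have hBη := (S.matrixOpNorm_field_le hN β v η).trans
    ((mul_le_mul_of_nonneg_left (hdeg v) (by positivity)).trans hR)
  refine (hmod _ _ hBω hBη φ L' hφm hφb hL' hφL).trans ?_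
  calc K * L' * frobNorm (S.field β v ω - S.field β v η)
      ≤ K * L' * (|β| / N * S.infl v y * suFrobDist (ω y) (η y)) :=
        mul_le_mul_of_nonneg_left (S.frobNorm_field_sub_le β v y hωη) (mul_nonneg hK hL')
    _ = K * (|β| / N) * S.infl v y * L' * suFrobDist (ω y) (η y) := by ring

/-- **Row sums of the Dobrushin coefficients**: `∑_{y ∈ nbr v} K (|β|/N) n(v,y) ≤ 3 D (|β|/N) K`. [folklore] -/
theorem sum_nbr_coeff_le {β K D : ℝ} (hK : 0 ≤ K) (hdeg : ∀ v, S.wdeg v ≤ D) (v : V) :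
    ∑ y ∈ S.nbr v, K * (|β| / N) * S.infl v y ≤ 3 * D * (|β| / N) * K := by
  rw [← Finset.mul_sum]
  calc K * (|β| / N) * ∑ y ∈ S.nbr v, S.infl v y ≤ K * (|β| / N) * (3 * D) :=
        mul_le_mul_of_nonneg_left ((S.sum_infl_le v).trans (by linarith [hdeg v])) (by positivity)
    _ = 3 * D * (|β| / N) * K := by ring

omit [Fintype P] in
/-- **One-link Lipschitz bound for the plaquette log-weight**: if `U = U'` off the link `l_k(q)`, then
`|w_β(U_q) − w_β(U'_q)| ≤ |β| √N ‖U_{l_k} − U'_{l_k}‖_F`. [folklore] -/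
theorem abs_suWeight_hol_sub_le (β : ℝ) (q : P) (k : Fin 4) {U U' : V → Matrix.specialUnitaryGroup (Fin N) ℂ}
    (hUU' : ∀ z, z ≠ S.lk q k → U z = U' z) :
    |suWeight N β (S.hol U q) - suWeight N β (S.hol U' q)| ≤
      |β| * Real.sqrt N * suFrobDist (U (S.lk q k)) (U' (S.lk q k)) := by
  set y := S.lk q k with hydef
  have hU : U = Function.update U y (U y) := (Function.update_eq_self y U).symm
  have hU' : U' = Function.update U y (U' y) := by
    funext z
    by_cases hz : z = y
    · subst hz; simp
    · rw [Function.update_of_ne hz, hUU' z hz]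
  have h1 := S.re_trace_hol_update (fundamentalRep (Fin N)) fundamentalRep_mem_unitaryGroup q k U (U y)
  have h2 := S.re_trace_hol_update (fundamentalRep (Fin N)) fundamentalRep_mem_unitaryGroup q k U (U' y)
  rw [← hydef, ← hU] at h1
  rw [← hydef, ← hU'] at h2
  simp only [fundamentalRep_apply] at h1 h2
  rw [suWeight, suWeight, h1, h2]
  have key := abs_re_trace_su_mul_sub_le (U y) (U' y)
    ((S.staple q k U : Matrix.specialUnitaryGroup (Fin N) ℂ) : Matrix (Fin N) (Fin N) ℂ)
  rw [frobNorm_su] at key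
  rw [show -(β * ((N : ℝ) - ((U y : Matrix (Fin N) (Fin N) ℂ) *
        ((S.staple q k U : Matrix.specialUnitaryGroup (Fin N) ℂ) : Matrix (Fin N) (Fin N) ℂ)).trace.re)) -
      -(β * ((N : ℝ) - ((U' y : Matrix (Fin N) (Fin N) ℂ) *
        ((S.staple q k U : Matrix.specialUnitaryGroup (Fin N) ℂ) : Matrix (Fin N) (Fin N) ℂ)).trace.re)) =
      β * (((U y : Matrix (Fin N) (Fin N) ℂ) *
        ((S.staple q k U : Matrix.specialUnitaryGroup (Fin N) ℂ) : Matrix (Fin N) (Fin N) ℂ)).trace.re -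
        ((U' y : Matrix (Fin N) (Fin N) ℂ) *
        ((S.staple q k U : Matrix.specialUnitaryGroup (Fin N) ℂ) : Matrix (Fin N) (Fin N) ℂ)).trace.re) by ring,
    abs_mul, mul_assoc]
  exact mul_le_mul_of_nonneg_left (by rw [mul_comm]; exact key) (abs_nonneg β)

end SUN

/-! ## §4 Smoothing by the weight specification of a plaquette system: locality and Lipschitz bounds -/

section Smoothing

variable {V P : Type*} [Fintype V] [Fintype P] [DecidableEq V] (S : PlaqSystem V P) {G : Type*} [Group G]
  [TopologicalSpace G] [IsTopologicalGroup G] [CompactSpace G] [MeasurableSpace G] [BorelSpace G]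
  [SecondCountableTopology G]

/-- The **plaquette closure** of a link set `Λ`: `Λ` together with every link of every plaquette through a link of `Λ`
(the dependence set of `γ_Λ f` for `f` measurable inside `Λ`). [folklore] -/
def closure (Λ : Finset V) : Finset V :=
  Λ ∪ Λ.biUnion fun v => (S.pthru v).biUnion S.links

omit [Fintype V] in
/-- A set of links is contained in its plaquette closure. [folklore] -/
theorem subset_closure (Λ : Finset V) : Λ ⊆ S.closure Λ := Finset.subset_union_left

omit [Fintype V] in
/-- Every link of a plaquette through a link of `Λ` lies in the plaquette closure of `Λ`. [folklore] -/
theorem mem_closure_of_mem_links {Λ : Finset V} {q : P} {e z : V} (he : e ∈ Λ) (heq : e ∈ S.links q)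
    (hz : z ∈ S.links q) : z ∈ S.closure Λ :=
  Finset.mem_union_right _ (Finset.mem_biUnion.2 ⟨e, he, Finset.mem_biUnion.2 ⟨q, (S.mem_pthru).2 heq, hz⟩⟩)

omit [Fintype V] [Fintype P] [DecidableEq V] [TopologicalSpace G] [IsTopologicalGroup G] [CompactSpace G]
  [MeasurableSpace G] [BorelSpace G] [SecondCountableTopology G] in
/-- Gluing the same inside data onto two outside configurations that agree on the links of `q` off `Λ` gives the same
holonomy around `q`. [folklore] -/
theorem hol_glueWith_congr (Λ : Finset V) (q : P) (ζ : ↥Λ → G) {σ τ : V → G}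
    (h : ∀ k, S.lk q k ∉ Λ → σ (S.lk q k) = τ (S.lk q k)) :
    S.hol (glueWith Λ ζ σ) q = S.hol (glueWith Λ ζ τ) q := by
  refine S.hol_congr fun k => ?_
  by_cases hzΛ : S.lk q k ∈ Λ
  · rw [glueWith_apply_mem _ _ _ hzΛ, glueWith_apply_mem _ _ _ hzΛ]
  · rw [glueWith_apply_not_mem _ _ _ hzΛ, glueWith_apply_not_mem _ _ _ hzΛ, h k hzΛ]

omit [Fintype V] [TopologicalSpace G] [IsTopologicalGroup G] [CompactSpace G] [MeasurableSpace G] [BorelSpace G]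
  [SecondCountableTopology G] in
/-- **Quasilocality of the energy shift**: if two outside configurations agree on the plaquette closure of `Λ`, the
energies of the glued configurations differ by a constant independent of the inside data. [folklore] -/
theorem exists_energy_glueWith_eq_add (w : G → ℝ) (Λ : Finset V) {σ τ : V → G}
    (h : ∀ z ∈ S.closure Λ, σ z = τ z) :
    ∃ κ : ℝ, ∀ ζ : ↥Λ → G, S.energy w (glueWith Λ ζ σ) = κ + S.energy w (glueWith Λ ζ τ) := by
  classical
  refine ⟨∑ q : P, if Disjoint (S.links q) Λ then
      S.coef q * w (S.hol σ q) - S.coef q * w (S.hol τ q) else 0, fun ζ => ?_⟩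
  unfold energy
  rw [← Finset.sum_add_distrib]
  refine Finset.sum_congr rfl fun q _ => ?_
  by_cases hq : Disjoint (S.links q) Λ
  · rw [if_pos hq]
    have h1 : ∀ ρ' : V → G, S.hol (glueWith Λ ζ ρ') q = S.hol ρ' q := fun ρ' =>
      S.hol_congr fun k => glueWith_apply_not_mem _ _ _ (Finset.disjoint_left.1 hq (S.lk_mem_links q k))
    rw [h1 σ, h1 τ]
    ring
  · rw [if_neg hq, zero_add]
    obtain ⟨e, heq, heΛ⟩ := Finset.not_disjoint_iff.1 hq
    rw [S.hol_glueWith_congr Λ q ζ fun k _ => h _ (S.mem_closure_of_mem_links heΛ heq (S.lk_mem_links q k))]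

omit [Fintype V] [TopologicalSpace G] [IsTopologicalGroup G] [CompactSpace G] [MeasurableSpace G] [BorelSpace G]
  [SecondCountableTopology G] in
/-- **One-link Lipschitz bound for the glued energy**: if the plaquette log-weight is `ℓ`-Lipschitz in each link of each
plaquette for the distance `r`, `y ∉ Λ` and `σ = τ` off `y`, then `|E(ζ σ_{Λᶜ}) − E(ζ τ_{Λᶜ})| ≤ wdeg(y) ℓ r(σ_y, τ_y)` for
every inside datum `ζ` (only the plaquettes through `y` change). [folklore] -/
theorem abs_energy_glueWith_sub_le {w : G → ℝ} {r : G → G → ℝ} {ℓ : ℝ}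
    (hwLip : ∀ (q : P) (k : Fin 4) (U U' : V → G), (∀ z, z ≠ S.lk q k → U z = U' z) →
      |w (S.hol U q) - w (S.hol U' q)| ≤ ℓ * r (U (S.lk q k)) (U' (S.lk q k)))
    (Λ : Finset V) {y : V} (hy : y ∉ Λ) {σ τ : V → G} (hστ : ∀ z, z ≠ y → σ z = τ z) (ζ : ↥Λ → G) :
    |S.energy w (glueWith Λ ζ σ) - S.energy w (glueWith Λ ζ τ)| ≤ S.wdeg y * (ℓ * r (σ y) (τ y)) := by
  classical
  have hagree : ∀ z, z ≠ y → glueWith Λ ζ σ z = glueWith Λ ζ τ z := fun z hz => by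
    by_cases hzΛ : z ∈ Λ
    · rw [glueWith_apply_mem _ _ _ hzΛ, glueWith_apply_mem _ _ _ hzΛ]
    · rw [glueWith_apply_not_mem _ _ _ hzΛ, glueWith_apply_not_mem _ _ _ hzΛ, hστ z hz]
  have hσy : glueWith Λ ζ σ y = σ y := glueWith_apply_not_mem _ _ _ hy
  have hτy : glueWith Λ ζ τ y = τ y := glueWith_apply_not_mem _ _ _ hy
  unfold energy
  rw [← Finset.sum_sub_distrib]
  refine (Finset.abs_sum_le_sum_abs _ _).trans ?_
  have hterm : ∀ q ∈ (Finset.univ : Finset P),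
      |S.coef q * w (S.hol (glueWith Λ ζ σ) q) - S.coef q * w (S.hol (glueWith Λ ζ τ) q)| ≤
        if y ∈ S.links q then S.coef q * (ℓ * r (σ y) (τ y)) else 0 := by
    intro q _
    rw [← mul_sub, abs_mul, abs_of_nonneg (S.coef_nonneg q)]
    split_ifs with hyq
    · obtain ⟨k, hk⟩ := (S.mem_links).1 hyq
      refine mul_le_mul_of_nonneg_left ?_ (S.coef_nonneg q)
      have h := hwLip q k _ _ fun z hz => hagree z (by rw [hk] at hz; exact hz)
      rw [hk, hσy, hτy] at h
      exact h
    · have hh : S.hol (glueWith Λ ζ σ) q = S.hol (glueWith Λ ζ τ) q :=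
        S.hol_congr fun k => hagree _ (by rintro h'; exact hyq ((S.mem_links).2 ⟨k, h'⟩))
      rw [hh, sub_self, abs_zero, mul_zero]
  refine (Finset.sum_le_sum hterm).trans ?_
  rw [← Finset.sum_filter, ← Finset.sum_mul]
  rfl

/-- **The smoothing of an observable measurable inside `Λ` depends only on the plaquette closure of `Λ`.** [folklore] -/
theorem dependsOn_specAvg_weightSpec {w : G → ℝ} (hw : Continuous w) (Λ : Finset V) {f : (V → G) → ℝ}
    (hfm : Measurable f) (hfdep : DependsOn f (↑Λ : Set V)) :
    DependsOn (specAvg (weightSpec (S.energy w)) Λ f) (↑(S.closure Λ) : Set V) := by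
  intro σ τ h
  obtain ⟨κ, hκ⟩ := S.exists_energy_glueWith_eq_add w Λ (σ := σ) (τ := τ) fun z hz => h z hz
  rw [specAvg_weightSpec_eq (S.measurable_energy hw) Λ hfm σ, specAvg_weightSpec_eq (S.measurable_energy hw) Λ hfm τ]
  have hint : ∀ ζ : ↥Λ → G, f (glueWith Λ ζ σ) = f (glueWith Λ ζ τ) := fun ζ => hfdep fun z hz => by
    rw [glueWith_apply_mem _ _ _ hz, glueWith_apply_mem _ _ _ hz]
  simp_rw [hint, hκ]
  rw [tilted_const_add_eq]

/-- **The smoothing is Lipschitz in every outside link** (Georgii 2011, Prop. 8.8: oscillation of a tilt, in metric form):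
if the plaquette log-weight is `ℓ`-Lipschitz in each link for a distance `r ≤ D` and the weighted degrees are `≤ Dg`, then
for `f` measurable inside `Λ` with `|f| ≤ M`, `|γ_Λ f(σ) − γ_Λ f(τ)| ≤ M (e^{2 Dg ℓ D} − 1)/D · r(σ_y, τ_y)` whenever
`σ = τ` off `y`. [cite: Georgii2011, Prop. 8.8] -/
theorem isLipBound_specAvg_weightSpec {w : G → ℝ} (hw : Continuous w) {r : G → G → ℝ} (hr0 : ∀ a b, 0 ≤ r a b)
    {D : ℝ} (hD : 0 < D) (hrD : ∀ a b, r a b ≤ D) {ℓ : ℝ} (hℓ : 0 ≤ ℓ)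
    (hwLip : ∀ (q : P) (k : Fin 4) (U U' : V → G), (∀ z, z ≠ S.lk q k → U z = U' z) →
      |w (S.hol U q) - w (S.hol U' q)| ≤ ℓ * r (U (S.lk q k)) (U' (S.lk q k)))
    {Dg : ℝ} (hDg : 0 ≤ Dg) (hdeg : ∀ v, S.wdeg v ≤ Dg)
    (Λ : Finset V) {f : (V → G) → ℝ} (hfm : Measurable f) (hfdep : DependsOn f (↑Λ : Set V)) {M : ℝ}
    (hM : ∀ σ, |f σ| ≤ M) :
    IsLipBound r (specAvg (weightSpec (S.energy w)) Λ f)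
      fun _ => M * ((Real.exp (D * (2 * (Dg * ℓ))) - 1) / D) := by
  have hM0 : 0 ≤ M := (abs_nonneg _).trans (hM fun _ => 1)
  set a : ℝ := 2 * (Dg * ℓ) with ha
  have ha0 : 0 ≤ a := by positivity
  have hE0 : 0 ≤ (Real.exp (D * a) - 1) / D :=
    div_nonneg (sub_nonneg.2 (Real.one_le_exp (by positivity))) hD.le
  have hEm := S.measurable_energy (G := G) hw
  refine ⟨fun _ => mul_nonneg hM0 hE0, fun y σ τ hστ => ?_⟩
  by_cases hy : y ∈ Λ
  · have hglue : ∀ ζ : ↥Λ → G, glueWith Λ ζ σ = glueWith Λ ζ τ := fun ζ => funext fun z => by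
      by_cases hzΛ : z ∈ Λ
      · rw [glueWith_apply_mem _ _ _ hzΛ, glueWith_apply_mem _ _ _ hzΛ]
      · rw [glueWith_apply_not_mem _ _ _ hzΛ, glueWith_apply_not_mem _ _ _ hzΛ,
          hστ z (by rintro rfl; exact hzΛ hy)]
    rw [specAvg_weightSpec_eq hEm Λ hfm σ, specAvg_weightSpec_eq hEm Λ hfm τ]
    simp_rw [hglue]
    rw [sub_self, abs_zero]
    exact mul_nonneg (mul_nonneg hM0 hE0) (hr0 _ _)
  · rw [specAvg_weightSpec_eq hEm Λ hfm σ, specAvg_weightSpec_eq hEm Λ hfm τ]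
    have hint : ∀ ζ : ↥Λ → G, f (glueWith Λ ζ τ) = f (glueWith Λ ζ σ) := fun ζ => hfdep fun z hz => by
      rw [glueWith_apply_mem _ _ _ hz, glueWith_apply_mem _ _ _ hz]
    simp_rw [hint]
    have h1m : Measurable fun ζ : ↥Λ → G => S.energy w (glueWith Λ ζ σ) := hEm.comp (measurable_glueWith Λ σ)
    have h2m : Measurable fun ζ : ↥Λ → G => S.energy w (glueWith Λ ζ τ) := hEm.comp (measurable_glueWith Λ τ)
    obtain ⟨B, hB⟩ := exists_abs_le_of_continuous (S.continuous_energy (G := G) hw)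
    have hφm : Measurable fun ζ : ↥Λ → G => f (glueWith Λ ζ σ) := hfm.comp (measurable_glueWith Λ σ)
    have hφL : ∀ a' b' : ↥Λ → G, |f (glueWith Λ a' σ) - f (glueWith Λ b' σ)| ≤ 2 * M := fun a' b' =>
      calc |f (glueWith Λ a' σ) - f (glueWith Λ b' σ)| ≤ |f (glueWith Λ a' σ)| + |f (glueWith Λ b' σ)| := abs_sub _ _
        _ ≤ M + M := add_le_add (hM _) (hM _)
        _ = 2 * M := by ring
    have hε : ∀ ζ : ↥Λ → G, |S.energy w (glueWith Λ ζ σ) - S.energy w (glueWith Λ ζ τ) - 0| ≤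
        Dg * (ℓ * r (σ y) (τ y)) := fun ζ => by
      rw [sub_zero]
      exact (S.abs_energy_glueWith_sub_le hwLip Λ hy hστ ζ).trans
        (mul_le_mul_of_nonneg_right (hdeg y) (mul_nonneg hℓ (hr0 _ _)))
    have key := abs_integral_tilted_sub_integral_tilted_le (Measure.pi fun _ : ↥Λ => haarProbability G) h1m h2m
      ⟨B, fun ζ => hB _⟩ ⟨B, fun ζ => hB _⟩ (κ := 0) (ε := Dg * (ℓ * r (σ y) (τ y))) hε hφm ⟨M, fun ζ => hM _⟩ hφL
    refine key.trans ?_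
    have hconv := exp_mul_sub_one_le_div_mul (k := r (σ y) (τ y)) (K := D) (t := a) (hr0 _ _) (hrD _ _) hD ha0
    have e1 : 2 * (Dg * (ℓ * r (σ y) (τ y))) = r (σ y) (τ y) * a := by rw [ha]; ring
    rw [e1]
    calc (Real.exp (r (σ y) (τ y) * a) - 1) / 2 * (2 * M) = M * (Real.exp (r (σ y) (τ y) * a) - 1) := by ring
      _ ≤ M * (r (σ y) (τ y) / D * (Real.exp (D * a) - 1)) := mul_le_mul_of_nonneg_left hconv hM0
      _ = M * ((Real.exp (D * a) - 1) / D) * r (σ y) (τ y) := by ring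

end Smoothing

/-! ## §5 Covariance decay for `SU(N)` plaquette systems in the Kantorovich–Rubinstein regime -/

section Covariance

variable {V P : Type*} [Fintype V] [Fintype P] [DecidableEq V] (S : PlaqSystem V P) {N : ℕ}

/-- The **smoothing Lipschitz factor** `E = (e^{4 Dg ℓ √N} − 1)/(2√N)` of `isLipBound_specAvg_weightSpec` for the Wilson
log-weight of `SU(N)` at tree coupling `β`: `ℓ = |β| √N` (`abs_suWeight_hol_sub_le`), `D = 2√N` (`suFrobDist_le`),
weighted degree `≤ Dg`. [folklore] -/
def suSmoothLip (N : ℕ) (Dg β : ℝ) : ℝ :=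
  (Real.exp (2 * Real.sqrt N * (2 * (Dg * (|β| * Real.sqrt N)))) - 1) / (2 * Real.sqrt N)

omit [Fintype V] [Fintype P] [DecidableEq V] S in
/-- The smoothing Lipschitz modulus is non-negative. [folklore] -/
theorem suSmoothLip_nonneg (hN : 1 ≤ N) {Dg : ℝ} (hDg : 0 ≤ Dg) (β : ℝ) : 0 ≤ suSmoothLip N Dg β := by
  unfold suSmoothLip
  have hN0 : (0 : ℝ) < N := by exact_mod_cast (show 0 < N by omega)
  exact div_nonneg (sub_nonneg.2 (Real.one_le_exp (by positivity))) (by positivity)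

/-- The **`SU(N)` weight measure** `Z⁻¹ exp(∑_q coef q · w_β(U_q)) ∏_v dU_v` of the plaquette system at tree coupling `β`.
[folklore] -/
def suMeasure (N : ℕ) (β : ℝ) : Measure (V → Matrix.specialUnitaryGroup (Fin N) ℂ) :=
  weightMeasure (S.energy (suWeight N β))

/-- **Covariance bound by DLR smoothing for `SU(N)` plaquette systems** (Föllmer 1988 Ch. I Thm. (2.13) with Remark (2.17),
Künsch 1982, Georgii 2011 §8.2; bounded measurable observables are first smoothed by `γ_{Δf}`, `γ_{Δg}` — DLR equations and
properness — into Lipschitz ones): with one-link modulus `OneLinkKRModulus N R K`, weighted degrees `≤ Dg`,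
`(|β|/N) Dg ≤ R` and Dobrushin constant `3 Dg (|β|/N) K ≤ c ≤ 1`, bounded measurable `f, g` depending on link sets `Δf, Δg`
with `closure Δf` disjoint from `Δg`, and a profile `ℓ` vanishing on `closure Δg` and `1`-Lipschitz along plaquette
neighbours, `|μ(fg) − μ(f)μ(g)| ≤ 2 (2√N)² (#closure Δg · M_g E) ∑_{y ∈ closure Δf} c^{ℓ y} M_f E`.
[cite: Follmer1988, Ch. I Theorem (2.13)] [cite: Georgii2011, Thm. 8.7, Thm. 8.20, Remark 8.26, §8.2] -/
theorem abs_integral_mul_sub_le_su (hN : 1 ≤ N) {β R K c Dg : ℝ} (hK : 0 ≤ K) (hDg : 0 ≤ Dg)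
    (hdeg : ∀ v, S.wdeg v ≤ Dg) (hR : |β| / N * Dg ≤ R) (hmod : OneLinkKRModulus N R K)
    (hc : 3 * Dg * (|β| / N) * K ≤ c) (hc1 : c ≤ 1)
    {f g : (V → Matrix.specialUnitaryGroup (Fin N) ℂ) → ℝ} (hfm : Measurable f)
    {Δf : Finset V} (hfdep : DependsOn f (↑Δf : Set V)) {Mf : ℝ} (hMf : ∀ σ, |f σ| ≤ Mf)
    (hgm : Measurable g) {Δg : Finset V} (hgdep : DependsOn g (↑Δg : Set V)) {Mg : ℝ}
    (hMg : ∀ σ, |g σ| ≤ Mg) (hsep : ∀ y ∈ S.closure Δf, y ∉ Δg) (ℓ : V → ℕ)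
    (hℓ0 : ∀ y ∈ S.closure Δg, ℓ y = 0) (hℓ : ∀ x ∉ S.closure Δg, ∀ y ∈ S.nbr x, ℓ x ≤ ℓ y + 1) :
    |(∫ σ, f σ * g σ ∂(S.suMeasure N β)) - (∫ σ, f σ ∂(S.suMeasure N β)) * ∫ σ, g σ ∂(S.suMeasure N β)| ≤
      2 * (2 * Real.sqrt N) ^ 2 * (∑ _y ∈ S.closure Δg, Mg * suSmoothLip N Dg β) *
        ∑ y ∈ S.closure Δf, c ^ ℓ y * (Mf * suSmoothLip N Dg β) := by
  classical
  haveI : SecondCountableTopology (Matrix (Fin N) (Fin N) ℂ) :=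
    inferInstanceAs (SecondCountableTopology (Fin N → Fin N → ℂ))
  haveI : SecondCountableTopology (Matrix.specialUnitaryGroup (Fin N) ℂ) :=
    Topology.IsEmbedding.subtypeVal.secondCountableTopology
  set μ := S.suMeasure N β with hμdef
  have hw := continuous_suWeight (N := N) β
  have hEm := S.measurable_energy (G := Matrix.specialUnitaryGroup (Fin N) ℂ) hw
  have hEb := exists_abs_le_of_continuous (S.continuous_energy (G := Matrix.specialUnitaryGroup (Fin N) ℂ) hw)
  have hγ := isSpecification_weightSpec (V := V) (G := Matrix.specialUnitaryGroup (Fin N) ℂ) hEm hEb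
  have hG : IsGibbsMeasure (weightSpec (S.energy (suWeight N β))) μ := isGibbsMeasure_weightMeasure hEm hEb
  haveI : IsProbabilityMeasure μ := hG.isProbabilityMeasure
  have hN0 : (0 : ℝ) < N := by exact_mod_cast (show 0 < N by omega)
  have hKR := S.isKRContraction_su hN hK hdeg hR hmod (β := β)
  have hc0 : 0 ≤ c := le_trans (by positivity) hc
  have hrow : ∀ v : V, ∑ y ∈ S.nbr v, K * (|β| / N) * S.infl v y ≤ c := fun v =>
    (S.sum_nbr_coeff_le hK hdeg v).trans hc
  -- the smoothed observables
  set fb := specAvg (weightSpec (S.energy (suWeight N β))) Δf f with hfb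
  set gb := specAvg (weightSpec (S.energy (suWeight N β))) Δg g with hgb
  have hfbm : Measurable fb := measurable_specAvg hγ Δf hfm
  have hgbm : Measurable gb := measurable_specAvg hγ Δg hgm
  have hfbM : ∀ σ, |fb σ| ≤ Mf := abs_specAvg_le hγ Δf hMf
  have hgbM : ∀ σ, |gb σ| ≤ Mg := abs_specAvg_le hγ Δg hMg
  have hfbdep : DependsOn fb (↑(S.closure Δf) : Set V) := S.dependsOn_specAvg_weightSpec hw Δf hfm hfdep
  have hgbdep : DependsOn gb (↑(S.closure Δg) : Set V) := S.dependsOn_specAvg_weightSpec hw Δg hgm hgdep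
  have hwLip : ∀ (q : P) (k : Fin 4) (U U' : V → Matrix.specialUnitaryGroup (Fin N) ℂ),
      (∀ z, z ≠ S.lk q k → U z = U' z) →
      |suWeight N β (S.hol U q) - suWeight N β (S.hol U' q)| ≤
        |β| * Real.sqrt N * suFrobDist (U (S.lk q k)) (U' (S.lk q k)) :=
    fun q k U U' hUU' => S.abs_suWeight_hol_sub_le β q k hUU'
  have hD : (0 : ℝ) < 2 * Real.sqrt N := by positivity
  have hfbLip : IsLipBound suFrobDist fb fun _ => Mf * suSmoothLip N Dg β :=
    S.isLipBound_specAvg_weightSpec hw suFrobDist_nonneg hD suFrobDist_le (by positivity) hwLip hDg hdeg Δf hfm hfdep hMf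
  have hgbLip : IsLipBound suFrobDist gb fun _ => Mg * suSmoothLip N Dg β :=
    S.isLipBound_specAvg_weightSpec hw suFrobDist_nonneg hD suFrobDist_le (by positivity) hwLip hDg hdeg Δg hgm hgdep hMg
  -- DLR identities: smoothing does not change the three integrals
  have h1 : ∫ σ, f σ * g σ ∂μ = ∫ σ, fb σ * gb σ ∂μ := by
    have ha : ∫ η, fb η * g η ∂μ = ∫ σ, f σ * g σ ∂μ :=
      integral_specAvg_mul hγ hG Δf hfm hMf hgm hMg hgdep fun x hx => hsep x (S.subset_closure Δf hx)
    have hb : ∫ η, gb η * fb η ∂μ = ∫ σ, g σ * fb σ ∂μ :=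
      integral_specAvg_mul hγ hG Δg hgm hMg hfbm hfbM hfbdep fun x hx hx' => hsep x hx' hx
    rw [← ha]
    have hb' : ∫ η, fb η * gb η ∂μ = ∫ σ, fb σ * g σ ∂μ := by
      simp_rw [mul_comm (fb _)]
      exact hb
    exact hb'.symm
  have h2 : ∫ σ, f σ ∂μ = ∫ σ, fb σ ∂μ := (integral_specAvg hγ hG Δf hfm hMf).symm
  have h3 : ∫ σ, g σ ∂μ = ∫ σ, gb σ ∂μ := (integral_specAvg hγ hG Δg hgm hMg).symm
  rw [h1, h2, h3]
  have key := abs_covariance_le_of_isKRContraction hγ hKR (r := suFrobDist) (R := 2 * Real.sqrt N)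
    suFrobDist_nonneg suFrobDist_le hD.le hc0 hc1 hrow hG hfbm hfbdep hfbM hfbLip hgbm hgbdep hgbM hgbLip ℓ hℓ0 hℓ
  have hcov : cov[fb, gb; μ] = (∫ σ, fb σ * gb σ ∂μ) - (∫ σ, fb σ ∂μ) * ∫ σ, gb σ ∂μ := by
    rw [covariance_eq_sub]
    · rfl
    · exact memLp_of_bounded (a := -Mf) (b := Mf) (ae_of_all _ fun σ => abs_le.1 (hfbM σ))
        hfbm.aestronglyMeasurable 2
    · exact memLp_of_bounded (a := -Mg) (b := Mg) (ae_of_all _ fun σ => abs_le.1 (hgbM σ))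
        hgbm.aestronglyMeasurable 2
  rw [hcov] at key
  exact key

end Covariance

end PlaqSystem

/-! ## §6 The Lüscher–Schaefer open-temporal-boundary slab as a plaquette system -/

section Slab

open PlaqSystem

/-- A `4`-vector with pairwise distinct entries is injective. [folklore] -/
theorem injective_vec4 {α : Type*} {a b c d : α} (hab : a ≠ b) (hac : a ≠ c) (had : a ≠ d) (hbc : b ≠ c)
    (hbd : b ≠ d) (hcd : c ≠ d) : Function.Injective ![a, b, c, d] := by
  intro i j h
  fin_cases i <;> fin_cases j <;> first | rfl | simp_all

variable (L T : ℕ)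

/-- **Links of the open slab** with `T+1` time slices of the spatial torus `(ℤ/L)³`: the spatial links `(t, e)`, `t ≤ T`,
`e : Edge 3 L`, and the temporal links `(i, x)`, `i < T`, `x : Site 3 L` (joining slice `i` to slice `i+1`). [folklore] -/
abbrev SlabLink : Type := (Fin (T + 1) × Edge 3 L) ⊕ (Fin T × Site 3 L)

/-- **Plaquettes of the open slab** in the Lüscher–Schaefer book-keeping by bonds `i < T`: the spatial plaquettes of slice
`i` and of slice `i+1` counted with weight `½` for the bond `i` (so an interior slice gets weight `½ + ½ = 1`, the two
terminal slices `½`), and the temporal plaquettes `(i, (x, k))` of the bond with weight `1`.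
[cite: LuscherSchaefer2011, §2.4] [cite: MontvayMunster1994, §3.2.6 (3.140)] -/
abbrev SlabPlaq : Type := (Fin T × Plaquette 3 L) ⊕ ((Fin T × Plaquette 3 L) ⊕ (Fin T × Edge 3 L))

/-- Named `DecidableEq` instance for the slab links (keeps synthesized `DecidablePred` terms below the instance-size
limit). [folklore] -/
instance instDecidableEqSlabLink : DecidableEq (SlabLink L T) := inferInstance

variable {L T}

/-- The four links of a spatial plaquette, in holonomy order. [folklore] -/
def spLink (p : Plaquette 3 L) : Fin 4 → Edge 3 L := ![tLink1 p, tLink2 p, tLink3 p, tLink4 p]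

/-- The four links of a spatial plaquette are distinct on a torus of side `≥ 2`. [folklore] -/
theorem spLink_injective [NeZero L] (hL : 1 < L) (p : Plaquette 3 L) : Function.Injective (spLink p) :=
  injective_vec4 (tLink1_ne_tLink2 p) (tLink1_ne_tLink3 hL p) (tLink1_ne_tLink4 p) (tLink2_ne_tLink3 p)
    (tLink2_ne_tLink4 hL p) (tLink3_ne_tLink4 p)

/-- The link map of the slab: spatial plaquettes of the bond `i` read slice `i` (left copy) or slice `i+1` (right copy);
the temporal plaquette `(i, (x, k))` is the word `g_x U'_{x,k} g_{x+e_k}⁻¹ U_{x,k}⁻¹` of `sliceTemporalAction`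
(`U` = slice `i`, `g` = temporal links of bond `i`, `U'` = slice `i+1`). [folklore] -/
def slabLk : SlabPlaq L T → Fin 4 → SlabLink L T
  | Sum.inl ip => fun k => Sum.inl (ip.1.castSucc, spLink ip.2 k)
  | Sum.inr (Sum.inl ip) => fun k => Sum.inl (ip.1.succ, spLink ip.2 k)
  | Sum.inr (Sum.inr ie) =>
      ![Sum.inr (ie.1, ie.2.1), Sum.inl (ie.1.succ, ie.2), Sum.inr (ie.1, ie.2.1.shift ie.2.2), Sum.inl (ie.1.castSucc, ie.2)]

/-- The Lüscher–Schaefer plaquette weights of the slab: `½` for the two spatial copies, `1` for temporal plaquettes.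
[cite: LuscherSchaefer2011, §2.4] -/
def slabCoef : SlabPlaq L T → ℝ
  | Sum.inl _ => 1 / 2
  | Sum.inr (Sum.inl _) => 1 / 2
  | Sum.inr (Sum.inr _) => 1

/-- The slab plaquette weights are non-negative. [folklore] -/
theorem slabCoef_nonneg (q : SlabPlaq L T) : 0 ≤ slabCoef q := by
  rcases q with _ | _ | _ <;> simp [slabCoef]

/-- The four letters of every slab plaquette word are distinct links (torus side `≥ 2`). [folklore] -/
theorem slabLk_injective [NeZero L] (hL : 1 < L) : ∀ q : SlabPlaq L T, Function.Injective (slabLk q)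
  | Sum.inl ip => fun a b h => spLink_injective hL ip.2 (Prod.mk.inj (Sum.inl.inj h)).2
  | Sum.inr (Sum.inl ip) => fun a b h => spLink_injective hL ip.2 (Prod.mk.inj (Sum.inl.inj h)).2
  | Sum.inr (Sum.inr ie) => by
      refine injective_vec4 Sum.inr_ne_inl ?_ Sum.inr_ne_inl Sum.inl_ne_inr ?_ Sum.inr_ne_inl
      · intro h
        exact shift_ne_self hL ie.2.1 ie.2.2 (Prod.mk.inj (Sum.inr.inj h)).2.symm
      · intro h
        exact (Fin.castSucc_lt_succ (i := ie.1)).ne' (Prod.mk.inj (Sum.inl.inj h)).1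

/-- **The open slab as a plaquette system.** [cite: LuscherSchaefer2011, §2.4] -/
def slab [NeZero L] (hL : 1 < L) : PlaqSystem (SlabLink L T) (SlabPlaq L T) where
  lk := slabLk
  lk_injective := slabLk_injective hL
  coef := slabCoef
  coef_nonneg := slabCoef_nonneg

variable [NeZero L] (hL : 1 < L)

/-- The link map of the slab system. [folklore] -/
@[simp] theorem slab_lk : (slab (T := T) hL).lk = slabLk := rfl
/-- The plaquette weights of the slab system. [folklore] -/
@[simp] theorem slab_coef : (slab (T := T) hL).coef = slabCoef := rfl

/-! ### Slices and the plaquette holonomies of the slab -/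

/-- The spatial configuration of slice `t`. [folklore] -/
def slices {G : Type*} (σ : SlabLink L T → G) (t : Fin (T + 1)) : GaugeConfig 3 L G := fun e => σ (Sum.inl (t, e))

/-- The temporal links of bond `i`. [folklore] -/
def tslices {G : Type*} (σ : SlabLink L T → G) (i : Fin T) : Site 3 L → G := fun x => σ (Sum.inr (i, x))

omit [NeZero L] in
/-- Reading off the slices is measurable. [folklore] -/
theorem measurable_slices {G : Type*} [MeasurableSpace G] :
    Measurable (slices : (SlabLink L T → G) → Fin (T + 1) → GaugeConfig 3 L G) :=
  measurable_pi_lambda _ fun _ => measurable_pi_lambda _ fun _ => measurable_pi_apply _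

/-- Holonomy of a left spatial copy: the spatial plaquette holonomy in slice `i`. [folklore] -/
theorem hol_slab_inl {G : Type*} [Group G] (σ : SlabLink L T → G) (i : Fin T) (p : Plaquette 3 L) :
    (slab hL).hol σ (Sum.inl (i, p)) = plaquetteHolonomy (slices σ i.castSucc) p.1 p.2.1.1 p.2.1.2 := rfl

/-- Holonomy of a right spatial copy: the spatial plaquette holonomy in slice `i+1`. [folklore] -/
theorem hol_slab_inr_inl {G : Type*} [Group G] (σ : SlabLink L T → G) (i : Fin T) (p : Plaquette 3 L) :
    (slab hL).hol σ (Sum.inr (Sum.inl (i, p))) = plaquetteHolonomy (slices σ i.succ) p.1 p.2.1.1 p.2.1.2 := rfl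

/-- Holonomy of a temporal plaquette: the word `g_x U'_{x,k} g_{x+e_k}⁻¹ U_{x,k}⁻¹` of `sliceTemporalAction`. [folklore] -/
theorem hol_slab_inr_inr {G : Type*} [Group G] (σ : SlabLink L T → G) (i : Fin T) (e : Edge 3 L) :
    (slab hL).hol σ (Sum.inr (Sum.inr (i, e))) =
      tslices σ i e.1 * slices σ i.succ e * (tslices σ i (e.1.shift e.2))⁻¹ * (slices σ i.castSucc e)⁻¹ := rfl

/-! ### The energy of the slab is the sum of the Lüscher–Schaefer bond energies -/

/-- The plaquette log-weight `−β (n − Re tr ρ(h))` of a matrix representation `ρ`. [folklore] -/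
def repWeight {G : Type*} [Group G] {n : ℕ} (ρ : G →* Matrix (Fin n) (Fin n) ℂ) (β : ℝ) (h : G) : ℝ :=
  -(β * ((n : ℝ) - (ρ h).trace.re))

/-- The representation log-weight is continuous for a continuous representation. [folklore] -/
theorem continuous_repWeight {G : Type*} [Group G] [TopologicalSpace G] {n : ℕ} {ρ : G →* Matrix (Fin n) (Fin n) ℂ}
    (hρ : Continuous ρ) (β : ℝ) : Continuous (repWeight ρ β) := by
  unfold repWeight
  refine (continuous_const.mul (continuous_const.sub ?_)).neg
  exact Complex.continuous_re.comp (hρ.matrix_trace)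

/-- The `SU(N)` Wilson log-weight is the log-weight of the fundamental representation. [folklore] -/
theorem suWeight_eq_repWeight {N : ℕ} (β : ℝ) : suWeight N β = repWeight (fundamentalRep (Fin N)) β := by
  funext h
  simp [suWeight, repWeight, fundamentalRep_apply]

/-- **The slab energy is the sum over bonds of `−β S₃(U_i)/2 − β S_tm(U_i, g_i, U_{i+1}) − β S₃(U_{i+1})/2`** — the exponents
of `wilsonSliceKernel`. [cite: LuscherSchaefer2011, §2.4] [cite: MontvayMunster1994, §3.2.6 (3.140)] -/
theorem slab_energy_eq {G : Type*} [Group G] {n : ℕ} (ρ : G →* Matrix (Fin n) (Fin n) ℂ) (β : ℝ)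
    (σ : SlabLink L T → G) :
    (slab hL).energy (repWeight ρ β) σ = ∑ i : Fin T,
      (-(β * wilsonAction ρ (slices σ i.castSucc) / 2) +
        -(β * sliceTemporalAction ρ (slices σ i.castSucc) (tslices σ i) (slices σ i.succ)) +
        -(β * wilsonAction ρ (slices σ i.succ) / 2)) := by
  unfold PlaqSystem.energy
  rw [Fintype.sum_sum_type, Fintype.sum_sum_type, Fintype.sum_prod_type, Fintype.sum_prod_type,
    Fintype.sum_prod_type, ← Finset.sum_add_distrib, ← Finset.sum_add_distrib]
  refine Finset.sum_congr rfl fun i _ => ?_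
  have hA : ∀ U : GaugeConfig 3 L G, ∑ p : Plaquette 3 L, (1 / 2 : ℝ) *
      repWeight ρ β (plaquetteHolonomy U p.1 p.2.1.1 p.2.1.2) = -(β * wilsonAction ρ U / 2) := by
    intro U
    unfold wilsonAction repWeight
    rw [mul_div_assoc, Finset.sum_div, Finset.mul_sum, ← Finset.sum_neg_distrib]
    exact Finset.sum_congr rfl fun p _ => by ring
  have hC : ∑ e : Edge 3 L, (1 : ℝ) * repWeight ρ β ((slab hL).hol σ (Sum.inr (Sum.inr (i, e)))) =
      -(β * sliceTemporalAction ρ (slices σ i.castSucc) (tslices σ i) (slices σ i.succ)) := by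
    unfold sliceTemporalAction repWeight
    rw [← Fintype.sum_prod_type', Finset.mul_sum, ← Finset.sum_neg_distrib]
    exact Finset.sum_congr rfl fun e _ => by rw [hol_slab_inr_inr]; ring
  simp only [slab_coef, slabCoef, hol_slab_inl, hol_slab_inr_inl]
  rw [hA, hA, hC]
  ring

/-! ### The weighted degree of every slab link is at most `6` -/

omit [NeZero L] in
/-- The letters of a spatial plaquette word are exactly its boundary links `plaqEdgesT`. [folklore] -/
theorem exists_spLink_eq_iff {p : Plaquette 3 L} {e : Edge 3 L} : (∃ k, spLink p k = e) ↔ e ∈ plaqEdgesT p := by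
  rw [plaqEdgesT_eq]
  simp only [Finset.mem_insert, Finset.mem_singleton]
  constructor
  · rintro ⟨k, rfl⟩
    fin_cases k <;> simp [spLink]
  · rintro (rfl | rfl | rfl | rfl)
    exacts [⟨0, rfl⟩, ⟨1, rfl⟩, ⟨2, rfl⟩, ⟨3, rfl⟩]

/-- Membership in the link set of a slab plaquette. [folklore] -/
theorem mem_links_slab_iff {q : SlabPlaq L T} {v : SlabLink L T} : v ∈ (slab hL).links q ↔ ∃ k, slabLk q k = v :=
  (slab hL).mem_links

/-- A spatial link `(t, e)` lies on a left spatial plaquette `(i, p)` only if `i = t` and `e ∈ p`. [folklore] -/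
theorem inl_mem_links_inl {t : Fin (T + 1)} {e : Edge 3 L} {i : Fin T} {p : Plaquette 3 L}
    (h : (Sum.inl (t, e) : SlabLink L T) ∈ (slab hL).links (Sum.inl (i, p))) : i.castSucc = t ∧ e ∈ plaqEdgesT p := by
  obtain ⟨k, hk⟩ := (mem_links_slab_iff hL).1 h
  obtain ⟨h1, h2⟩ := Prod.mk.inj (Sum.inl.inj hk)
  exact ⟨h1, exists_spLink_eq_iff.1 ⟨k, h2⟩⟩

/-- A spatial link on a right spatial copy of bond `i` lies in slice `i+1` on the plaquette boundary. [folklore] -/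
theorem inl_mem_links_inr_inl {t : Fin (T + 1)} {e : Edge 3 L} {i : Fin T} {p : Plaquette 3 L}
    (h : (Sum.inl (t, e) : SlabLink L T) ∈ (slab hL).links (Sum.inr (Sum.inl (i, p)))) :
    i.succ = t ∧ e ∈ plaqEdgesT p := by
  obtain ⟨k, hk⟩ := (mem_links_slab_iff hL).1 h
  obtain ⟨h1, h2⟩ := Prod.mk.inj (Sum.inl.inj hk)
  exact ⟨h1, exists_spLink_eq_iff.1 ⟨k, h2⟩⟩

/-- A spatial link on a temporal plaquette `(i, e')` is `e'` itself, in slice `i` or `i+1`. [folklore] -/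
theorem inl_mem_links_inr_inr {t : Fin (T + 1)} {e : Edge 3 L} {i : Fin T} {e' : Edge 3 L}
    (h : (Sum.inl (t, e) : SlabLink L T) ∈ (slab hL).links (Sum.inr (Sum.inr (i, e')))) :
    e' = e ∧ (i.succ = t ∨ i.castSucc = t) := by
  obtain ⟨k, hk⟩ := (mem_links_slab_iff hL).1 h
  fin_cases k <;> simp [slabLk] at hk
  · exact ⟨hk.2, Or.inl hk.1⟩
  · exact ⟨hk.2, Or.inr hk.1⟩

/-- Temporal links do not occur in left spatial copies. [folklore] -/
theorem inr_not_mem_links_inl {i₀ : Fin T} {x : Site 3 L} {i : Fin T} {p : Plaquette 3 L} :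
    (Sum.inr (i₀, x) : SlabLink L T) ∉ (slab hL).links (Sum.inl (i, p)) := fun h => by
  obtain ⟨k, hk⟩ := (mem_links_slab_iff hL).1 h
  exact Sum.inl_ne_inr hk

/-- Temporal links do not occur in right spatial copies. [folklore] -/
theorem inr_not_mem_links_inr_inl {i₀ : Fin T} {x : Site 3 L} {i : Fin T} {p : Plaquette 3 L} :
    (Sum.inr (i₀, x) : SlabLink L T) ∉ (slab hL).links (Sum.inr (Sum.inl (i, p))) := fun h => by
  obtain ⟨k, hk⟩ := (mem_links_slab_iff hL).1 h
  exact Sum.inl_ne_inr hk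

/-- A temporal link on a temporal plaquette `(i, e')` belongs to bond `i` and sits at an endpoint of `e'`. [folklore] -/
theorem inr_mem_links_inr_inr {i₀ : Fin T} {x : Site 3 L} {i : Fin T} {e' : Edge 3 L}
    (h : (Sum.inr (i₀, x) : SlabLink L T) ∈ (slab hL).links (Sum.inr (Sum.inr (i, e')))) :
    i = i₀ ∧ (e'.1 = x ∨ e'.1.shift e'.2 = x) := by
  obtain ⟨k, hk⟩ := (mem_links_slab_iff hL).1 h
  fin_cases k <;> simp [slabLk] at hk
  · exact ⟨hk.1, Or.inl hk.2⟩
  · exact ⟨hk.1, Or.inr hk.2⟩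

omit [NeZero L] in
/-- At most one `i : Fin T` has a given `castSucc`. [folklore] -/
theorem card_filter_castSucc_le (t : Fin (T + 1)) :
    (Finset.univ.filter fun i : Fin T => i.castSucc = t).card ≤ 1 :=
  Finset.card_le_one.2 fun _ ha _ hb => Fin.castSucc_injective _
    ((Finset.mem_filter.1 ha).2.trans (Finset.mem_filter.1 hb).2.symm)

omit [NeZero L] in
/-- At most one `i : Fin T` has a given `succ`. [folklore] -/
theorem card_filter_succ_le (t : Fin (T + 1)) :
    (Finset.univ.filter fun i : Fin T => i.succ = t).card ≤ 1 :=
  Finset.card_le_one.2 fun _ ha _ hb => Fin.succ_injective _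
    ((Finset.mem_filter.1 ha).2.trans (Finset.mem_filter.1 hb).2.symm)

/-- At most one site shifts to a given site in a given direction. [folklore] -/
theorem card_filter_shift_le (x : Site 3 L) (k : Fin 3) :
    (Finset.univ.filter fun x' : Site 3 L => x'.shift k = x).card ≤ 1 :=
  Finset.card_le_one.2 fun _ ha _ hb => add_left_injective (Pi.single k (1 : ZMod L))
    ((Finset.mem_filter.1 ha).2.trans (Finset.mem_filter.1 hb).2.symm)

/-- Bounded indicator sums: `∑ (if P then a else 0) ≤ a · #filter ≤ a · n`. [folklore] -/
theorem sum_ite_le_of_card_le {ι : Type*} (s : Finset ι) (P : ι → Prop) [DecidablePred P] {a : ℝ} (ha : 0 ≤ a)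
    {n : ℕ} (hn : (s.filter P).card ≤ n) : ∑ i ∈ s, (if P i then a else 0) ≤ n * a := by
  rw [← Finset.sum_filter, Finset.sum_const, nsmul_eq_mul]
  exact mul_le_mul_of_nonneg_right (by exact_mod_cast hn) ha

/-- **Every link of the open slab has weighted plaquette degree at most `6`** (interior spatial link: `4·½ + 4·½ + 2`;
boundary spatial link: `4·½ + 1`; temporal link: `6`). [cite: LuscherSchaefer2011, §2.4] -/
theorem wdeg_slab_le (v : SlabLink L T) : (slab hL).wdeg v ≤ 6 := by
  unfold PlaqSystem.wdeg PlaqSystem.pthru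
  rw [Finset.sum_filter, Fintype.sum_sum_type, Fintype.sum_sum_type]
  simp only [slab_coef, slabCoef]
  rcases v with ⟨t, e⟩ | ⟨i₀, x⟩
  · -- spatial link `(t, e)`: ≤ 4 plaquettes of slice `t` seen from below (weight 1/2, only if `t = i.castSucc`),
    -- ≤ 4 seen from above (weight 1/2, only if `t = i.succ`), ≤ 2 temporal plaquettes (weight 1)
    have hP : (plaqsThrough e).card ≤ 4 := (card_plaqsThrough_le e).trans (by norm_num)
    have hA : ∑ ip : Fin T × Plaquette 3 L,
        (if (Sum.inl (t, e) : SlabLink L T) ∈ (slab hL).links (Sum.inl ip) then (1 / 2 : ℝ) else 0) ≤ 2 := by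
      refine (sum_ite_le_of_card_le _ _ (by norm_num) (n := 4) ?_).trans (by norm_num)
      calc (Finset.univ.filter fun ip : Fin T × Plaquette 3 L =>
              (Sum.inl (t, e) : SlabLink L T) ∈ (slab hL).links (Sum.inl ip)).card
          ≤ ((Finset.univ.filter fun i : Fin T => i.castSucc = t) ×ˢ plaqsThrough e).card := by
            refine Finset.card_le_card fun ip hip => ?_
            obtain ⟨h2, h3⟩ := inl_mem_links_inl hL (Finset.mem_filter.1 hip).2
            exact Finset.mem_product.2 ⟨Finset.mem_filter.2 ⟨Finset.mem_univ _, h2⟩, mem_plaqsThrough.2 h3⟩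
        _ ≤ 1 * 4 := by
            rw [Finset.card_product]
            exact Nat.mul_le_mul (card_filter_castSucc_le t) hP
        _ = 4 := by norm_num
    have hB : ∑ ip : Fin T × Plaquette 3 L,
        (if (Sum.inl (t, e) : SlabLink L T) ∈ (slab hL).links (Sum.inr (Sum.inl ip)) then (1 / 2 : ℝ) else 0) ≤ 2 := by
      refine (sum_ite_le_of_card_le _ _ (by norm_num) (n := 4) ?_).trans (by norm_num)
      calc (Finset.univ.filter fun ip : Fin T × Plaquette 3 L =>
              (Sum.inl (t, e) : SlabLink L T) ∈ (slab hL).links (Sum.inr (Sum.inl ip))).card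
          ≤ ((Finset.univ.filter fun i : Fin T => i.succ = t) ×ˢ plaqsThrough e).card := by
            refine Finset.card_le_card fun ip hip => ?_
            obtain ⟨h2, h3⟩ := inl_mem_links_inr_inl hL (Finset.mem_filter.1 hip).2
            exact Finset.mem_product.2 ⟨Finset.mem_filter.2 ⟨Finset.mem_univ _, h2⟩, mem_plaqsThrough.2 h3⟩
        _ ≤ 1 * 4 := by
            rw [Finset.card_product]
            exact Nat.mul_le_mul (card_filter_succ_le t) hP
        _ = 4 := by norm_num
    have hC : ∑ ie : Fin T × Edge 3 L,
        (if (Sum.inl (t, e) : SlabLink L T) ∈ (slab hL).links (Sum.inr (Sum.inr ie)) then (1 : ℝ) else 0) ≤ 2 := by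
      refine (sum_ite_le_of_card_le _ _ zero_le_one (n := 2) ?_).trans (by norm_num)
      calc (Finset.univ.filter fun ie : Fin T × Edge 3 L =>
              (Sum.inl (t, e) : SlabLink L T) ∈ (slab hL).links (Sum.inr (Sum.inr ie))).card
          ≤ (((Finset.univ.filter fun i : Fin T => i.succ = t) ∪
              (Finset.univ.filter fun i : Fin T => i.castSucc = t)) ×ˢ ({e} : Finset (Edge 3 L))).card := by
            refine Finset.card_le_card fun ie hie => ?_
            obtain ⟨he, ht⟩ := inl_mem_links_inr_inr hL (Finset.mem_filter.1 hie).2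
            refine Finset.mem_product.2 ⟨Finset.mem_union.2 ?_, Finset.mem_singleton.2 he⟩
            rcases ht with ht | ht
            · exact Or.inl (Finset.mem_filter.2 ⟨Finset.mem_univ _, ht⟩)
            · exact Or.inr (Finset.mem_filter.2 ⟨Finset.mem_univ _, ht⟩)
        _ ≤ (1 + 1) * 1 := by
            rw [Finset.card_product, Finset.card_singleton]
            exact Nat.mul_le_mul_right _ ((Finset.card_union_le _ _).trans
              (Nat.add_le_add (card_filter_succ_le t) (card_filter_castSucc_le t)))
        _ = 2 := by norm_num
    linarith
  · -- temporal link `(i₀, x)`: no spatial plaquettes; ≤ 6 temporal plaquettes `(i₀, e')` with `x` an endpoint of `e'`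
    have hA : ∑ ip : Fin T × Plaquette 3 L,
        (if (Sum.inr (i₀, x) : SlabLink L T) ∈ (slab hL).links (Sum.inl ip) then (1 / 2 : ℝ) else 0) = 0 :=
      Finset.sum_eq_zero fun ip _ => if_neg (inr_not_mem_links_inl hL)
    have hB : ∑ ip : Fin T × Plaquette 3 L,
        (if (Sum.inr (i₀, x) : SlabLink L T) ∈ (slab hL).links (Sum.inr (Sum.inl ip)) then (1 / 2 : ℝ) else 0) = 0 :=
      Finset.sum_eq_zero fun ip _ => if_neg (inr_not_mem_links_inr_inl hL)
    have hE₁ : (Finset.univ.filter fun e' : Edge 3 L => e'.1 = x).card ≤ 3 :=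
      calc (Finset.univ.filter fun e' : Edge 3 L => e'.1 = x).card
          ≤ ((Finset.univ : Finset (Fin 3)).image fun k => ((x, k) : Edge 3 L)).card := by
            refine Finset.card_le_card fun e' he' => ?_
            have h := (Finset.mem_filter.1 he').2
            exact Finset.mem_image.2 ⟨e'.2, Finset.mem_univ _, Prod.ext h.symm rfl⟩
        _ ≤ 3 := Finset.card_image_le.trans (by simp)
    have hE₂ : (Finset.univ.filter fun e' : Edge 3 L => e'.1.shift e'.2 = x).card ≤ 3 :=
      calc (Finset.univ.filter fun e' : Edge 3 L => e'.1.shift e'.2 = x).card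
          ≤ ((Finset.univ : Finset (Fin 3)).image fun k => ((x - Pi.single k 1, k) : Edge 3 L)).card := by
            refine Finset.card_le_card fun e' he' => ?_
            have h : e'.1 + Pi.single e'.2 (1 : ZMod L) = x := (Finset.mem_filter.1 he').2
            exact Finset.mem_image.2 ⟨e'.2, Finset.mem_univ _,
              Prod.ext (show x - Pi.single e'.2 (1 : ZMod L) = e'.1 by rw [← h, add_sub_cancel_right]) rfl⟩
        _ ≤ 3 := Finset.card_image_le.trans (by simp)
    have hC : ∑ ie : Fin T × Edge 3 L,
        (if (Sum.inr (i₀, x) : SlabLink L T) ∈ (slab hL).links (Sum.inr (Sum.inr ie)) then (1 : ℝ) else 0) ≤ 6 := by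
      refine (sum_ite_le_of_card_le _ _ zero_le_one (n := 6) ?_).trans (by norm_num)
      calc (Finset.univ.filter fun ie : Fin T × Edge 3 L =>
              (Sum.inr (i₀, x) : SlabLink L T) ∈ (slab hL).links (Sum.inr (Sum.inr ie))).card
          ≤ (({i₀} : Finset (Fin T)) ×ˢ ((Finset.univ.filter fun e' : Edge 3 L => e'.1 = x) ∪
              (Finset.univ.filter fun e' : Edge 3 L => e'.1.shift e'.2 = x))).card := by
            refine Finset.card_le_card fun ie hie => ?_
            obtain ⟨hi, hx⟩ := inr_mem_links_inr_inr hL (Finset.mem_filter.1 hie).2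
            refine Finset.mem_product.2 ⟨Finset.mem_singleton.2 hi, Finset.mem_union.2 ?_⟩
            rcases hx with hx | hx
            · exact Or.inl (Finset.mem_filter.2 ⟨Finset.mem_univ _, hx⟩)
            · exact Or.inr (Finset.mem_filter.2 ⟨Finset.mem_univ _, hx⟩)
        _ ≤ 1 * (3 + 3) := by
            rw [Finset.card_product, Finset.card_singleton]
            exact Nat.mul_le_mul_left _ ((Finset.card_union_le _ _).trans (Nat.add_le_add hE₁ hE₂))
        _ = 6 := by norm_num
    linarith

/-! ### Time levels of links; slices, closures and the decay profile -/

/-- Twice the time coordinate of a link: `2t` for a spatial link of slice `t`, `2i+1` for a temporal link of bond `i`.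
[folklore] -/
def linkTime : SlabLink L T → ℕ
  | Sum.inl te => 2 * (te.1 : ℕ)
  | Sum.inr ix => 2 * (ix.1 : ℕ) + 1

/-- Twice the earliest time of a plaquette. [folklore] -/
def plaqTime : SlabPlaq L T → ℕ
  | Sum.inl ip => 2 * (ip.1 : ℕ)
  | Sum.inr (Sum.inl ip) => 2 * (ip.1 : ℕ) + 2
  | Sum.inr (Sum.inr ie) => 2 * (ie.1 : ℕ)

omit [NeZero L] in
/-- Every letter of a plaquette word has link time in `[plaqTime, plaqTime + 2]`. [folklore] -/
theorem linkTime_slabLk (q : SlabPlaq L T) (k : Fin 4) :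
    plaqTime q ≤ linkTime (slabLk q k) ∧ linkTime (slabLk q k) ≤ plaqTime q + 2 := by
  rcases q with ip | ip | ie
  · simp [slabLk, linkTime, plaqTime]
  · simp [slabLk, linkTime, plaqTime, Fin.val_succ]; omega
  · fin_cases k <;> simp [slabLk, linkTime, plaqTime, Fin.val_succ]
    all_goals omega

/-- Every link of a plaquette has link time in `[plaqTime, plaqTime + 2]`. [folklore] -/
theorem linkTime_of_mem_links {q : SlabPlaq L T} {v : SlabLink L T} (hv : v ∈ (slab hL).links q) :
    plaqTime q ≤ linkTime v ∧ linkTime v ≤ plaqTime q + 2 := by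
  obtain ⟨k, rfl⟩ := (mem_links_slab_iff hL).1 hv
  exact linkTime_slabLk q k

/-- Plaquette neighbours are at most one time unit apart. [folklore] -/
theorem linkTime_nbr {x y : SlabLink L T} (hy : y ∈ (slab hL).nbr x) :
    linkTime x ≤ linkTime y + 2 ∧ linkTime y ≤ linkTime x + 2 := by
  unfold PlaqSystem.nbr at hy
  obtain ⟨q, hq, hyq⟩ := Finset.mem_biUnion.1 (Finset.mem_of_mem_erase hy)
  have hx := linkTime_of_mem_links hL ((slab hL).mem_pthru.1 hq)
  have hy' := linkTime_of_mem_links hL hyq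
  omega

/-- The plaquette closure of `Λ` stays within one time unit of `Λ`. [folklore] -/
theorem linkTime_closure {Λ : Finset (SlabLink L T)} {y : SlabLink L T} (hy : y ∈ (slab hL).closure Λ) :
    ∃ x ∈ Λ, linkTime x ≤ linkTime y + 2 ∧ linkTime y ≤ linkTime x + 2 := by
  unfold PlaqSystem.closure at hy
  rcases Finset.mem_union.1 hy with h | h
  · exact ⟨y, h, by omega, by omega⟩
  · obtain ⟨x, hx, h2⟩ := Finset.mem_biUnion.1 h
    obtain ⟨q, hq, hyq⟩ := Finset.mem_biUnion.1 h2
    have h3 := linkTime_of_mem_links hL ((slab hL).mem_pthru.1 hq)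
    have h4 := linkTime_of_mem_links hL hyq
    exact ⟨x, hx, by omega, by omega⟩

/-- The spatial links of slice `t`. [folklore] -/
def sliceLinks (t : Fin (T + 1)) : Finset (SlabLink L T) :=
  Finset.univ.image fun e : Edge 3 L => Sum.inl (t, e)

/-- The links of slice `t` have link time `2t`. [folklore] -/
theorem linkTime_of_mem_sliceLinks {t : Fin (T + 1)} {v : SlabLink L T} (hv : v ∈ sliceLinks t) :
    linkTime v = 2 * (t : ℕ) := by
  obtain ⟨e, _, rfl⟩ := Finset.mem_image.1 hv
  rfl

/-- A function of slice `t` depends only on the links of slice `t`. [folklore] -/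
theorem dependsOn_slices {G : Type*} (f : GaugeConfig 3 L G → ℝ) (t : Fin (T + 1)) :
    DependsOn (fun σ : SlabLink L T → G => f (slices σ t))
      ((sliceLinks (L := L) t : Finset (SlabLink L T)) : Set (SlabLink L T)) := by
  intro σ τ h
  have : slices σ t = slices τ t := funext fun e =>
    h _ (Finset.mem_coe.2 (Finset.mem_image.2 ⟨e, Finset.mem_univ _, rfl⟩))
  simp only [this]

/-- **The plaquette closure of a slice has at most `3·#Edge + 2·#Site` links** (the spatial links of the slices `t−1, t, t+1`
and the temporal links of the bonds `t−1, t`), uniformly in `T`. [folklore] -/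
theorem card_closure_sliceLinks_le (t : Fin (T + 1)) :
    ((slab hL).closure (sliceLinks t)).card ≤ 3 * Fintype.card (Edge 3 L) + 2 * Fintype.card (Site 3 L) := by
  have hsub : (slab hL).closure (sliceLinks t) ⊆
      ((Finset.univ.filter fun t' : Fin (T + 1) => (t : ℕ) ≤ (t' : ℕ) + 1 ∧ (t' : ℕ) ≤ (t : ℕ) + 1) ×ˢ
          (Finset.univ : Finset (Edge 3 L))).disjSum
        ((Finset.univ.filter fun i : Fin T => (t : ℕ) ≤ (i : ℕ) + 1 ∧ (i : ℕ) ≤ (t : ℕ)) ×ˢ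
          (Finset.univ : Finset (Site 3 L))) := by
    intro y hy
    obtain ⟨x, hx, h⟩ := linkTime_closure hL hy
    rw [linkTime_of_mem_sliceLinks hx] at h
    rcases y with ⟨t', e⟩ | ⟨i, x'⟩
    · have h' : 2 * (t : ℕ) ≤ 2 * (t' : ℕ) + 2 ∧ 2 * (t' : ℕ) ≤ 2 * (t : ℕ) + 2 := h
      exact Finset.inl_mem_disjSum.2
        (Finset.mk_mem_product (Finset.mem_filter.2 ⟨Finset.mem_univ _, by omega, by omega⟩) (Finset.mem_univ _))
    · have h' : 2 * (t : ℕ) ≤ 2 * (i : ℕ) + 1 + 2 ∧ 2 * (i : ℕ) + 1 ≤ 2 * (t : ℕ) + 2 := h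
      exact Finset.inr_mem_disjSum.2
        (Finset.mk_mem_product (Finset.mem_filter.2 ⟨Finset.mem_univ _, by omega, by omega⟩) (Finset.mem_univ _))
  have hA : (Finset.univ.filter fun t' : Fin (T + 1) => (t : ℕ) ≤ (t' : ℕ) + 1 ∧ (t' : ℕ) ≤ (t : ℕ) + 1).card ≤ 3 :=
    calc (Finset.univ.filter fun t' : Fin (T + 1) => (t : ℕ) ≤ (t' : ℕ) + 1 ∧ (t' : ℕ) ≤ (t : ℕ) + 1).card
        ≤ (Finset.Icc ((t : ℕ) - 1) ((t : ℕ) + 1)).card := by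
          refine Finset.card_le_card_of_injOn (fun t' => (t' : ℕ)) (fun t' ht' => ?_) (fun a _ b _ h => Fin.ext h)
          have h := (Finset.mem_filter.1 (Finset.mem_coe.1 ht')).2
          simp only [Finset.coe_Icc, Set.mem_Icc]
          omega
      _ ≤ 3 := by rw [Nat.card_Icc]; omega
  have hB : (Finset.univ.filter fun i : Fin T => (t : ℕ) ≤ (i : ℕ) + 1 ∧ (i : ℕ) ≤ (t : ℕ)).card ≤ 2 :=
    calc (Finset.univ.filter fun i : Fin T => (t : ℕ) ≤ (i : ℕ) + 1 ∧ (i : ℕ) ≤ (t : ℕ)).card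
        ≤ (Finset.Icc ((t : ℕ) - 1) (t : ℕ)).card := by
          refine Finset.card_le_card_of_injOn (fun i => (i : ℕ)) (fun i hi => ?_) (fun a _ b _ h => Fin.ext h)
          have h := (Finset.mem_filter.1 (Finset.mem_coe.1 hi)).2
          simp only [Finset.coe_Icc, Set.mem_Icc]
          omega
      _ ≤ 2 := by rw [Nat.card_Icc]; omega
  refine (Finset.card_le_card hsub).trans ?_
  rw [Finset.card_disjSum, Finset.card_product, Finset.card_product, Finset.card_univ, Finset.card_univ]
  exact Nat.add_le_add (Nat.mul_le_mul_right _ hA) (Nat.mul_le_mul_right _ hB)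

end Slab

/-! ## §7 Identification: the open-boundary expectation is the Gibbs expectation of the slab (Fubini)

`openExpectation ρ β L T` (tree, `MassGapOpenBoundary`) integrates slice configurations `u, ζ₁, …, ζ_T` against the
product of slice kernels `K_β(U_i, U_{i+1})`, each of which is itself a Haar integral over the temporal links of the bond.
Undoing that inner integration (Fubini over the temporal links, then re-assembling the `T+1` slices and the `T` temporal
layers into ONE product Haar measure over `SlabLink L T`) identifies it with the expectation in the finite-volume Gibbs
measure `weightMeasure (energy of the slab)` — item (ii) of the NOT-PROVED list of `MassGapOpenBoundary`. -/

section Identification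

open PlaqSystem Literature.MathematicalPhysics.QuantumFieldTheory.Balaban1983to89.Sufficient.OpenBoundary

/-- Bounded measurable real functions on a finite measure space are integrable. [folklore] -/
theorem integrable_of_measurable_abs_le {α : Type*} [MeasurableSpace α] {μ : Measure α} [IsFiniteMeasure μ]
    {f : α → ℝ} (hfm : Measurable f) {M : ℝ} (hM : ∀ x, |f x| ≤ M) : Integrable f μ :=
  Integrable.of_bound hfm.aestronglyMeasurable M (ae_of_all _ fun x => by rw [Real.norm_eq_abs]; exact hM x)

/-- **Currying is measure preserving** from the product probability measure on `ι × κ → X` to the iterated product on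
`ι → κ → X` (Mathlib's `Measure.infinitePi_map_curry` on finite index types). [folklore] -/
theorem measurePreserving_curry (ι κ X : Type*) [Fintype ι] [Fintype κ] [MeasurableSpace X] (μ : Measure X)
    [IsProbabilityMeasure μ] :
    MeasurePreserving (MeasurableEquiv.curry ι κ X) (Measure.pi fun _ : ι × κ => μ)
      (Measure.pi fun _ : ι => Measure.pi fun _ : κ => μ) := by
  refine ⟨(MeasurableEquiv.curry ι κ X).measurable, ?_⟩
  have h := Measure.infinitePi_map_curry (X := X) (fun (_ : ι) (_ : κ) => μ)
  simpa only [Measure.infinitePi_eq_pi] using h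

/-- Fubini over the first index of `ι × κ`: `∫ ∏ᵢ Fᵢ(b(i,·)) d(⊗_{ι×κ} μ) = ∏ᵢ ∫ Fᵢ d(⊗_κ μ)`. [folklore] -/
theorem integral_prod_curry_eq {ι κ X : Type*} [Fintype ι] [Fintype κ] [MeasurableSpace X] (μ : Measure X)
    [IsProbabilityMeasure μ] (F : ι → (κ → X) → ℝ) :
    ∫ b : ι × κ → X, ∏ i, F i (fun x => b (i, x)) ∂(Measure.pi fun _ => μ) =
      ∏ i, ∫ c : κ → X, F i c ∂(Measure.pi fun _ => μ) := by
  rw [← integral_fintype_prod_eq_prod, ← (measurePreserving_curry ι κ X μ).integral_comp']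
  rfl

/-- Evaluation of a slice observable. [folklore] -/
theorem sliceObs_apply {L T : ℕ} {G : Type*} (f : GaugeConfig 3 L G → ℝ) (S : Finset ℕ) (t : Fin (T + 1)) (U : GaugeConfig 3 L G) :
    sliceObs L T f S t U = if (t : ℕ) ∈ S then f U else 1 := by
  unfold sliceObs
  split_ifs <;> rfl

/-- The product observable of `sliceObs f {s}` is `f(U_s)`. [folklore] -/
theorem prod_sliceObs_singleton {L T : ℕ} {G : Type*} {s : ℕ} (hs : s < T + 1) (f : GaugeConfig 3 L G → ℝ)
    (u : Fin (T + 1) → GaugeConfig 3 L G) :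
    ∏ t' : Fin (T + 1), sliceObs L T f {s} t' (u t') = f (u ⟨s, hs⟩) := by
  simp_rw [sliceObs_apply, Finset.mem_singleton]
  rw [Finset.prod_eq_single_of_mem (⟨s, hs⟩ : Fin (T + 1)) (Finset.mem_univ _)
    fun t' _ ht' => if_neg fun h => ht' (Fin.ext h)]
  exact if_pos rfl

/-- The product observable of `sliceObs f {s, s + t}`, `t ≥ 1`, is `f(U_s) f(U_{s+t})`. [folklore] -/
theorem prod_sliceObs_pair {L T : ℕ} {G : Type*} {s t : ℕ} (ht : 1 ≤ t) (hs : s < T + 1) (hst : s + t < T + 1)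
    (f : GaugeConfig 3 L G → ℝ) (u : Fin (T + 1) → GaugeConfig 3 L G) :
    ∏ t' : Fin (T + 1), sliceObs L T f {s, s + t} t' (u t') = f (u ⟨s, hs⟩) * f (u ⟨s + t, hst⟩) := by
  simp_rw [sliceObs_apply, Finset.mem_insert, Finset.mem_singleton]
  have hne : (⟨s, hs⟩ : Fin (T + 1)) ≠ ⟨s + t, hst⟩ := fun h => by
    have h' := congrArg Fin.val h
    simp only at h'
    omega
  rw [Finset.prod_eq_mul (⟨s, hs⟩ : Fin (T + 1)) ⟨s + t, hst⟩ hne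
    (fun c _ hc => if_neg (by rintro (h | h); exacts [hc.1 (Fin.ext h), hc.2 (Fin.ext h)]))
    (fun h => absurd (Finset.mem_univ _) h) (fun h => absurd (Finset.mem_univ _) h)]
  rw [if_pos (Or.inl rfl), if_pos (Or.inr rfl)]

variable {L T : ℕ} [NeZero L] (hL : 1 < L)
variable {G : Type*} [Group G] [TopologicalSpace G] [IsTopologicalGroup G] [CompactSpace G] [MeasurableSpace G]
  [BorelSpace G] [SecondCountableTopology G] {n : ℕ} {ρ : G →* Matrix (Fin n) (Fin n) ℂ}

/-- **The slab integral is the Lüscher–Schaefer open chain** (Fubini; the temporal links of bond `i` integrate to the slice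
kernel `K_β(U_i, U_{i+1})`): for every bounded measurable function `Φ` of the slices,
`∫ e^{E(σ)} Φ(slices σ) ∏ dσ = ∫ du ∫ dζ (∏ᵢ K_β) · Φ(u ∷ ζ)`. [cite: LuscherSchaefer2011, §2.4 and §2.5]
[cite: MontvayMunster1994, §3.2.6 (3.140)] -/
theorem integral_slab_eq (hρ : Continuous ρ) (β : ℝ) {Φ : (Fin (T + 1) → GaugeConfig 3 L G) → ℝ}
    (hΦm : Measurable Φ) {B : ℝ} (hΦb : ∀ u, |Φ u| ≤ B) :
    ∫ σ, Real.exp ((slab hL).energy (repWeight ρ β) σ) * Φ (slices σ)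
        ∂(Measure.pi fun _ : SlabLink L T => haarProbability G) =
      ∫ u : GaugeConfig 3 L G, ∫ ζ : Fin T → GaugeConfig 3 L G,
        openSliceWeight (wilsonSliceKernel ρ β) T u ζ * Φ (Fin.cons u ζ)
        ∂(Measure.pi fun _ => Measure.pi fun _ : Edge 3 L => haarProbability G)
        ∂(Measure.pi fun _ : Edge 3 L => haarProbability G) := by
  have hK := stronglyMeasurable_uncurry_wilsonSliceKernel (L := L) ρ hρ β
  obtain ⟨C, hC⟩ := exists_norm_wilsonSliceKernel_le (L := L) ρ hρ β
  obtain ⟨Cₑ, hCe⟩ := exists_abs_le_of_continuous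
    ((slab (T := T) hL).continuous_energy (G := G) (continuous_repWeight hρ β))
  have hB0 : 0 ≤ B := (abs_nonneg _).trans (hΦb fun _ _ => 1)
  -- the integrand and its integrability
  have hgm : Measurable fun σ : SlabLink L T → G =>
      Real.exp ((slab hL).energy (repWeight ρ β) σ) * Φ (slices σ) :=
    (Real.measurable_exp.comp ((slab hL).measurable_energy (continuous_repWeight hρ β))).mul
      (hΦm.comp measurable_slices)
  have hgb : ∀ σ : SlabLink L T → G,
      |Real.exp ((slab hL).energy (repWeight ρ β) σ) * Φ (slices σ)| ≤ Real.exp Cₑ * B := fun σ => by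
    rw [abs_mul, Real.abs_exp]
    exact mul_le_mul (Real.exp_le_exp.2 ((le_abs_self _).trans (hCe σ))) (hΦb _) (abs_nonneg _)
      (Real.exp_pos _).le
  -- step 1: separate spatial links `a` and temporal links `b`
  have h1 := (measurePreserving_sumPiEquivProdPi_symm fun _ : SlabLink L T => haarProbability G).integral_comp'
    (g := fun σ => Real.exp ((slab hL).energy (repWeight ρ β) σ) * Φ (slices σ))
  -- step 2: for fixed spatial links, the temporal layers factorise bond by bond
  have hpt : ∀ (a : Fin (T + 1) × Edge 3 L → G) (b : Fin T × Site 3 L → G),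
      Real.exp ((slab hL).energy (repWeight ρ β)
          ((MeasurableEquiv.sumPiEquivProdPi fun _ : SlabLink L T => G).symm (a, b))) *
        Φ (slices ((MeasurableEquiv.sumPiEquivProdPi fun _ : SlabLink L T => G).symm (a, b))) =
      Φ (Function.curry a) * ∏ i : Fin T,
        (Real.exp (-(β * wilsonAction ρ (Function.curry a i.castSucc) / 2)) *
          Real.exp (-(β * sliceTemporalAction ρ (Function.curry a i.castSucc) (fun x => b (i, x))
            (Function.curry a i.succ))) *
          Real.exp (-(β * wilsonAction ρ (Function.curry a i.succ) / 2))) := by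
    intro a b
    rw [slab_energy_eq, Real.exp_sum, mul_comm]
    simp_rw [Real.exp_add]
    rfl
  have hinner : ∀ a : Fin (T + 1) × Edge 3 L → G,
      ∫ b, Real.exp ((slab hL).energy (repWeight ρ β)
          ((MeasurableEquiv.sumPiEquivProdPi fun _ : SlabLink L T => G).symm (a, b))) *
        Φ (slices ((MeasurableEquiv.sumPiEquivProdPi fun _ : SlabLink L T => G).symm (a, b)))
        ∂(Measure.pi fun _ : Fin T × Site 3 L => haarProbability G) =
      Φ (Function.curry a) * ∏ i : Fin T,
        wilsonSliceKernel ρ β (Function.curry a i.castSucc) (Function.curry a i.succ) := by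
    intro a
    simp_rw [hpt a]
    rw [integral_const_mul, integral_prod_curry_eq (haarProbability G) fun (i : Fin T) (c : Site 3 L → G) =>
      Real.exp (-(β * wilsonAction ρ (Function.curry a i.castSucc) / 2)) *
        Real.exp (-(β * sliceTemporalAction ρ (Function.curry a i.castSucc) c (Function.curry a i.succ))) *
        Real.exp (-(β * wilsonAction ρ (Function.curry a i.succ) / 2))]
    congr 1
    refine Finset.prod_congr rfl fun i _ => ?_
    rw [integral_mul_const, integral_const_mul]
    rfl
  -- step 3: the spatial links `a` are the `T+1` slices
  have hKm : ∀ i : Fin T, Measurable fun u' : Fin (T + 1) → GaugeConfig 3 L G =>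
      wilsonSliceKernel ρ β (u' i.castSucc) (u' i.succ) := fun i => by
    have h := hK.measurable.comp
      ((measurable_pi_apply (X := fun _ : Fin (T + 1) => GaugeConfig 3 L G) (Fin.castSucc i)).prodMk
        (measurable_pi_apply (X := fun _ : Fin (T + 1) => GaugeConfig 3 L G) i.succ))
    simpa only [Function.comp_def, Function.uncurry_apply_pair] using h
  have hΨm : Measurable fun u' : Fin (T + 1) → GaugeConfig 3 L G =>
      Φ u' * ∏ i : Fin T, wilsonSliceKernel ρ β (u' i.castSucc) (u' i.succ) :=
    hΦm.mul (Finset.measurable_prod _ fun i _ => hKm i)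
  have hΨb : ∀ u' : Fin (T + 1) → GaugeConfig 3 L G,
      |Φ u' * ∏ i : Fin T, wilsonSliceKernel ρ β (u' i.castSucc) (u' i.succ)| ≤ B * C ^ T := fun u' => by
    rw [abs_mul, Finset.abs_prod]
    refine mul_le_mul (hΦb u') ?_ (Finset.prod_nonneg fun i _ => abs_nonneg _) hB0
    calc ∏ i : Fin T, |wilsonSliceKernel ρ β (u' i.castSucc) (u' i.succ)| ≤ ∏ _i : Fin T, C :=
          Finset.prod_le_prod (fun i _ => abs_nonneg _) fun i _ => (Real.norm_eq_abs _).symm.le.trans (hC _ _)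
      _ = C ^ T := by simp
  have h4 := (measurePreserving_curry (Fin (T + 1)) (Edge 3 L) G (haarProbability G)).integral_comp'
    (g := fun u' : Fin (T + 1) → GaugeConfig 3 L G =>
      Φ u' * ∏ i : Fin T, wilsonSliceKernel ρ β (u' i.castSucc) (u' i.succ))
  have h5 := (measurePreserving_piFinSuccAbove
    (fun _ : Fin (T + 1) => (Measure.pi fun _ : Edge 3 L => haarProbability G)) 0).symm
  have hsymm : ∀ (u : GaugeConfig 3 L G) (ζ : Fin T → GaugeConfig 3 L G),
      (MeasurableEquiv.piFinSuccAbove (fun _ : Fin (T + 1) => GaugeConfig 3 L G) 0).symm (u, ζ) = Fin.cons u ζ :=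
    fun u ζ => by
      funext j
      simp only [MeasurableEquiv.piFinSuccAbove_symm_apply, Fin.insertNthEquiv_apply, Fin.insertNth_zero']
  calc ∫ σ, Real.exp ((slab hL).energy (repWeight ρ β) σ) * Φ (slices σ)
        ∂(Measure.pi fun _ : SlabLink L T => haarProbability G)
      = ∫ p, Real.exp ((slab hL).energy (repWeight ρ β)
            ((MeasurableEquiv.sumPiEquivProdPi fun _ : SlabLink L T => G).symm p)) *
          Φ (slices ((MeasurableEquiv.sumPiEquivProdPi fun _ : SlabLink L T => G).symm p))
          ∂((Measure.pi fun _ : Fin (T + 1) × Edge 3 L => haarProbability G).prod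
            (Measure.pi fun _ : Fin T × Site 3 L => haarProbability G)) := h1.symm
    _ = ∫ a, ∫ b, Real.exp ((slab hL).energy (repWeight ρ β)
            ((MeasurableEquiv.sumPiEquivProdPi fun _ : SlabLink L T => G).symm (a, b))) *
          Φ (slices ((MeasurableEquiv.sumPiEquivProdPi fun _ : SlabLink L T => G).symm (a, b)))
          ∂(Measure.pi fun _ : Fin T × Site 3 L => haarProbability G)
          ∂(Measure.pi fun _ : Fin (T + 1) × Edge 3 L => haarProbability G) :=
        integral_prod _ (integrable_of_measurable_abs_le (hgm.comp (MeasurableEquiv.measurable _)) fun p => hgb _)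
    _ = ∫ a, Φ (Function.curry a) * ∏ i : Fin T,
          wilsonSliceKernel ρ β (Function.curry a i.castSucc) (Function.curry a i.succ)
          ∂(Measure.pi fun _ : Fin (T + 1) × Edge 3 L => haarProbability G) :=
        integral_congr_ae (ae_of_all _ hinner)
    _ = ∫ u', Φ u' * ∏ i : Fin T, wilsonSliceKernel ρ β (u' i.castSucc) (u' i.succ)
          ∂(Measure.pi fun _ : Fin (T + 1) => Measure.pi fun _ : Edge 3 L => haarProbability G) := h4
    _ = ∫ p, (Φ ((MeasurableEquiv.piFinSuccAbove (fun _ : Fin (T + 1) => GaugeConfig 3 L G) 0).symm p) *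
          ∏ i : Fin T, wilsonSliceKernel ρ β
            ((MeasurableEquiv.piFinSuccAbove (fun _ : Fin (T + 1) => GaugeConfig 3 L G) 0).symm p i.castSucc)
            ((MeasurableEquiv.piFinSuccAbove (fun _ : Fin (T + 1) => GaugeConfig 3 L G) 0).symm p i.succ))
          ∂((Measure.pi fun _ : Edge 3 L => haarProbability G).prod
            (Measure.pi fun _ : Fin T => Measure.pi fun _ : Edge 3 L => haarProbability G)) :=
        (h5.integral_comp' fun u' : Fin (T + 1) → GaugeConfig 3 L G =>
          Φ u' * ∏ i : Fin T, wilsonSliceKernel ρ β (u' i.castSucc) (u' i.succ)).symm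
    _ = ∫ u, ∫ ζ, (Φ ((MeasurableEquiv.piFinSuccAbove (fun _ : Fin (T + 1) => GaugeConfig 3 L G) 0).symm (u, ζ)) *
          ∏ i : Fin T, wilsonSliceKernel ρ β
            ((MeasurableEquiv.piFinSuccAbove (fun _ : Fin (T + 1) => GaugeConfig 3 L G) 0).symm (u, ζ) i.castSucc)
            ((MeasurableEquiv.piFinSuccAbove (fun _ : Fin (T + 1) => GaugeConfig 3 L G) 0).symm (u, ζ) i.succ))
          ∂(Measure.pi fun _ : Fin T => Measure.pi fun _ : Edge 3 L => haarProbability G)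
          ∂(Measure.pi fun _ : Edge 3 L => haarProbability G) :=
        integral_prod _ (integrable_of_measurable_abs_le (hΨm.comp (MeasurableEquiv.measurable _)) fun p => hΨb _)
    _ = _ := by
        refine integral_congr_ae (ae_of_all _ fun u => integral_congr_ae (ae_of_all _ fun ζ => ?_))
        dsimp only
        rw [hsymm u ζ]
        simp only [Fin.cons_succ]
        rw [mul_comm]
        rfl

/-- **Open-boundary expectations are slab Gibbs expectations**: for bounded measurable slice observables `g_t`,
`openExpectation ρ β L T g = ∫ ∏_t g_t(slices σ t) dμ_slab(σ)` with `μ_slab = weightMeasure (energy of the slab)` — the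
identification of the Lüscher–Schaefer open chain with the full link-variable functional integral on the slab
(item (ii) of `MassGapOpenBoundary`'s NOT-PROVED list). [cite: LuscherSchaefer2011, §2.4 and §2.5]
[cite: MontvayMunster1994, §3.2.6 (3.140)] -/
theorem openExpectation_eq_integral_weightMeasure (hρ : Continuous ρ) (β : ℝ) (T : ℕ)
    {g : Fin (T + 1) → GaugeConfig 3 L G → ℝ} (hg : ∀ t, Measurable (g t)) {B : ℝ} (hB : ∀ t U, |g t U| ≤ B) :
    openExpectation ρ β L T g =
      ∫ σ, (∏ t, g t (slices σ t)) ∂(weightMeasure ((slab (T := T) hL).energy (repWeight ρ β))) := by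
  have hΦm : Measurable fun u' : Fin (T + 1) → GaugeConfig 3 L G => ∏ t, g t (u' t) :=
    Finset.measurable_prod _ fun t _ => (hg t).comp (measurable_pi_apply t)
  have hΦb : ∀ u' : Fin (T + 1) → GaugeConfig 3 L G, |∏ t, g t (u' t)| ≤ max B 1 ^ (T + 1) := fun u' => by
    rw [Finset.abs_prod]
    calc ∏ t, |g t (u' t)| ≤ ∏ _t : Fin (T + 1), max B 1 :=
          Finset.prod_le_prod (fun t _ => abs_nonneg _) fun t _ => (hB t _).trans (le_max_left _ _)
      _ = max B 1 ^ (T + 1) := by simp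
  have hnum := integral_slab_eq hL hρ β hΦm hΦb
  have hden := integral_slab_eq (T := T) hL hρ β (Φ := fun _ => (1 : ℝ)) measurable_const (B := 1)
    (fun _ => by simp)
  simp only [mul_one] at hden
  unfold openExpectation openPartitionFunction weightMeasure
  rw [integral_tilted]
  simp_rw [smul_eq_mul, div_mul_eq_mul_div]
  rw [integral_div, hnum, hden]

end Identification

/-! ## §8 Exponential clustering in time of the open chain; the transfer-operator gap (currency SC-c)

Föllmer's covariance estimate of §5 on the slab `SlabLink L T` for the two slice observables `f(U_s)` and `f(U_{s+t})`
(supports `sliceLinks s`, `sliceLinks (s+t)`, smoothed supports their plaquette closures, which lie in link-time windows of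
half-width `2` around `2s` and `2(s+t)`), with the profile `ℓ(v) = (|τ(v) − 2(s+t)|/2 − 1)₊` (a `1`-Lipschitz exhaustion by
neighbourhoods, `= 0` on the closure of the far slice and `≥ t − 2` on the closure of the near one), gives
`|cov| ≤ 32 N C_L² M² E_β² · 4 · c'^t` with `c' = max(c, ½)`, `c = 18 (|β|/N) K`, `C_L = 3·#Edge + 2·#Site` and the constant
INDEPENDENT of `T, s, t` — i.e. `OpenBoundaryTimeClustering` at rate `krRate c = −log c'` for every bounded measurable `f`.
The tree's `transferOperatorGap_of_openBoundaryTimeClustering` (ir-2, `MassGapOpenBoundaryConversion`) converts it into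
`TransferOperatorGap (fundamentalRep (Fin N)) β S (krRate c)` for every `S ≥ 1`, whence `CrossoverLedger.LatticeMassGap`. -/

section Clustering

open PlaqSystem Literature.MathematicalPhysics.QuantumFieldTheory.Balaban1983to89.Sufficient
  Literature.MathematicalPhysics.QuantumFieldTheory.Balaban1983to89.Sufficient.OpenBoundary

variable {L T : ℕ} [NeZero L] (hL : 1 < L)

/-- The link-time distance profile from slice `t₀`: `ℓ_{t₀}(v) = (|τ(v) − 2 t₀| / 2 − 1)₊` (natural-number arithmetic).
[folklore] -/
def sliceProfile (t₀ : ℕ) (v : SlabLink L T) : ℕ := (linkTime v - 2 * t₀ + (2 * t₀ - linkTime v)) / 2 - 1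

/-- The profile vanishes on the plaquette closure of its own slice. [folklore] -/
theorem sliceProfile_eq_zero_of_mem_closure {t₀ : Fin (T + 1)} {v : SlabLink L T}
    (hv : v ∈ (slab hL).closure (sliceLinks t₀)) : sliceProfile (t₀ : ℕ) v = 0 := by
  obtain ⟨x, hx, h⟩ := linkTime_closure hL hv
  rw [linkTime_of_mem_sliceLinks hx] at h
  unfold sliceProfile
  omega

/-- The profile is `1`-Lipschitz along the neighbour relation of the slab. [folklore] -/
theorem sliceProfile_nbr (t₀ : ℕ) {x y : SlabLink L T} (hy : y ∈ (slab hL).nbr x) :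
    sliceProfile t₀ x ≤ sliceProfile t₀ y + 1 := by
  have h := linkTime_nbr hL hy
  unfold sliceProfile
  omega

/-- On the plaquette closure of slice `s` the profile from slice `t₀` is at least `t₀ − s − 2`. [folklore] -/
theorem le_sliceProfile_of_mem_closure {s : Fin (T + 1)} (t₀ : ℕ) {v : SlabLink L T}
    (hv : v ∈ (slab hL).closure (sliceLinks s)) : t₀ - s - 2 ≤ sliceProfile t₀ v := by
  obtain ⟨x, hx, h⟩ := linkTime_closure hL hv
  rw [linkTime_of_mem_sliceLinks hx] at h
  unfold sliceProfile
  omega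

/-- The plaquette closure of slice `s` does not meet slice `t₀` if `t₀ ≥ s + 2`. [folklore] -/
theorem not_mem_sliceLinks_of_mem_closure {s t₀ : Fin (T + 1)} (hst : (s : ℕ) + 2 ≤ t₀) {v : SlabLink L T}
    (hv : v ∈ (slab hL).closure (sliceLinks s)) : v ∉ sliceLinks t₀ := by
  intro hv'
  obtain ⟨x, hx, h⟩ := linkTime_closure hL hv
  rw [linkTime_of_mem_sliceLinks hx, linkTime_of_mem_sliceLinks hv'] at h
  omega

/-- `c^{t−2} ≤ 4 c^t` for `c ≥ ½`. [folklore] -/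
theorem pow_sub_two_le {c : ℝ} (hc : 1 / 2 ≤ c) {t : ℕ} (ht : 2 ≤ t) : c ^ (t - 2) ≤ 4 * c ^ t := by
  obtain ⟨k, rfl⟩ : ∃ k, t = k + 2 := ⟨t - 2, by omega⟩
  rw [Nat.add_sub_cancel, pow_add]
  have hc0 : 0 ≤ c := by linarith
  nlinarith [pow_nonneg hc0 k, mul_nonneg (pow_nonneg hc0 k) (by nlinarith : (0 : ℝ) ≤ 4 * c ^ 2 - 1)]

include hL in
/-- **Exponential clustering in time of the `SU(N)` open chain in the Kantorovich–Rubinstein window** (Föllmer's form of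
Dobrushin uniqueness, run on the finite slab): if `OneLinkKRModulus N R K` with `6|β|/N ≤ R` and
`c = 18 (|β|/N) K < 1`, then for every spatial torus `(ℤ/L)³`, `L ≥ 2`, every bounded measurable slice observable `f` has
`|⟨f(U_s) f(U_{s+t})⟩ − ⟨f(U_s)⟩⟨f(U_{s+t})⟩| ≤ K_f e^{−m t}` in the open chain of ANY length `T ≥ s + t`, with
`m = krRate c = −log max(c, ½)` and `K_f` independent of `T, s, t`.  Method: [cite: Follmer1988, Thm. (2.13) and
Remark (2.17)]; [cite: Georgii2011, Prop. 8.8, Thm. 8.7, (8.20)]; the Wilson slab and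
its transfer-matrix reading [cite: LuscherSchaefer2011, §2.5], [cite: MontvayMunster1994, §3.2.6 (3.140)]. -/
theorem openBoundaryTimeClustering_of_oneLinkKRModulus {N : ℕ} (hN : 1 ≤ N) {β R K c : ℝ} (hK : 0 ≤ K)
    (hR : |β| / N * 6 ≤ R) (hmod : OneLinkKRModulus N R K) (hc : 18 * (|β| / N) * K ≤ c) (hc1 : c < 1) :
    OpenBoundaryTimeClustering (fundamentalRep (Fin N)) β L
      {f : GaugeConfig 3 L (Matrix.specialUnitaryGroup (Fin N) ℂ) → ℝ | Measurable f ∧ ∃ B : ℝ, ∀ U, |f U| ≤ B}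
      (krRate c) := by
  haveI : SecondCountableTopology (Matrix (Fin N) (Fin N) ℂ) :=
    inferInstanceAs (SecondCountableTopology (Fin N → Fin N → ℂ))
  haveI : SecondCountableTopology (Matrix.specialUnitaryGroup (Fin N) ℂ) :=
    Topology.IsEmbedding.subtypeVal.secondCountableTopology
  unfold OpenBoundaryTimeClustering
  rintro f ⟨hfm, M, hM⟩
  have hM0 : 0 ≤ M := (abs_nonneg _).trans (hM fun _ => 1)
  have hρc : Continuous (fundamentalRep (Fin N)) := continuous_fundamentalRep (Fin N)
  -- constants
  have hc'1 : max c (1 / 2) ≤ 1 := max_le hc1.le (by norm_num)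
  have hc'h : 1 / 2 ≤ max c (1 / 2) := le_max_right _ _
  have hc'0 : 0 < max c (1 / 2) := lt_of_lt_of_le (by norm_num) hc'h
  have hcc' : 3 * 6 * (|β| / N) * K ≤ max c (1 / 2) := by
    rw [show 3 * 6 * (|β| / N) * K = 18 * (|β| / N) * K by ring]
    exact hc.trans (le_max_left _ _)
  have hE0 : 0 ≤ suSmoothLip N 6 β := suSmoothLip_nonneg hN (by norm_num) β
  have hME : 0 ≤ M * suSmoothLip N 6 β := mul_nonneg hM0 hE0
  have hA0 : 0 ≤ 2 * (2 * Real.sqrt N) ^ 2 *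
      (((3 * Fintype.card (Edge 3 L) + 2 * Fintype.card (Site 3 L) : ℕ) : ℝ) * (M * suSmoothLip N 6 β)) *
      (((3 * Fintype.card (Edge 3 L) + 2 * Fintype.card (Site 3 L) : ℕ) : ℝ) * (4 * (M * suSmoothLip N 6 β))) :=
    mul_nonneg (mul_nonneg (by positivity) (mul_nonneg (Nat.cast_nonneg _) hME))
      (mul_nonneg (Nat.cast_nonneg _) (mul_nonneg (by norm_num) hME))
  refine ⟨2 * (2 * Real.sqrt N) ^ 2 *
      (((3 * Fintype.card (Edge 3 L) + 2 * Fintype.card (Site 3 L) : ℕ) : ℝ) * (M * suSmoothLip N 6 β)) *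
      (((3 * Fintype.card (Edge 3 L) + 2 * Fintype.card (Site 3 L) : ℕ) : ℝ) * (4 * (M * suSmoothLip N 6 β))) +
      4 * M ^ 2, fun T s t ht hst => ?_⟩
  have hsT : s < T + 1 := by omega
  have hstT : s + t < T + 1 := by omega
  -- the slab Gibbs measure and the identification of §7
  have hEm := (slab (T := T) hL).measurable_energy (G := Matrix.specialUnitaryGroup (Fin N) ℂ)
    (continuous_repWeight hρc β)
  have hEb := exists_abs_le_of_continuous ((slab (T := T) hL).continuous_energy
    (G := Matrix.specialUnitaryGroup (Fin N) ℂ) (continuous_repWeight hρc β))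
  have hG := isGibbsMeasure_weightMeasure hEm hEb
  haveI : IsProbabilityMeasure
      (weightMeasure ((slab (T := T) hL).energy (repWeight (fundamentalRep (Fin N)) β))) :=
    hG.isProbabilityMeasure
  have hμ : (slab (T := T) hL).suMeasure N β =
      weightMeasure ((slab (T := T) hL).energy (repWeight (fundamentalRep (Fin N)) β)) := by
    rw [PlaqSystem.suMeasure, suWeight_eq_repWeight]
  have hsm : ∀ (A : Finset ℕ) (t' : Fin (T + 1)), Measurable (sliceObs L T f A t') := fun A t' => by
    unfold sliceObs
    split_ifs
    exacts [hfm, measurable_const]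
  have hsb : ∀ (A : Finset ℕ) (t' : Fin (T + 1)) (U : GaugeConfig 3 L (Matrix.specialUnitaryGroup (Fin N) ℂ)),
      |sliceObs L T f A t' U| ≤ max M 1 := fun A t' U => by
    rw [sliceObs_apply]
    split_ifs
    · exact (hM U).trans (le_max_left _ _)
    · rw [abs_one]; exact le_max_right _ _
  have hE2 : openExpectation (fundamentalRep (Fin N)) β L T (sliceObs L T f {s, s + t}) =
      ∫ σ, f (slices σ ⟨s, hsT⟩) * f (slices σ ⟨s + t, hstT⟩)
        ∂(weightMeasure ((slab (T := T) hL).energy (repWeight (fundamentalRep (Fin N)) β))) := by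
    rw [openExpectation_eq_integral_weightMeasure hL hρc β T (hsm _) (hsb _)]
    exact integral_congr_ae (ae_of_all _ fun σ => prod_sliceObs_pair ht hsT hstT f (slices σ))
  have hEs : openExpectation (fundamentalRep (Fin N)) β L T (sliceObs L T f {s}) =
      ∫ σ, f (slices σ ⟨s, hsT⟩)
        ∂(weightMeasure ((slab (T := T) hL).energy (repWeight (fundamentalRep (Fin N)) β))) := by
    rw [openExpectation_eq_integral_weightMeasure hL hρc β T (hsm _) (hsb _)]
    exact integral_congr_ae (ae_of_all _ fun σ => prod_sliceObs_singleton hsT f (slices σ))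
  have hEst : openExpectation (fundamentalRep (Fin N)) β L T (sliceObs L T f {s + t}) =
      ∫ σ, f (slices σ ⟨s + t, hstT⟩)
        ∂(weightMeasure ((slab (T := T) hL).energy (repWeight (fundamentalRep (Fin N)) β))) := by
    rw [openExpectation_eq_integral_weightMeasure hL hρc β T (hsm _) (hsb _)]
    exact integral_congr_ae (ae_of_all _ fun σ => prod_sliceObs_singleton hstT f (slices σ))
  have hexp : Real.exp (-(krRate c * (t : ℝ))) = max c (1 / 2) ^ t := by
    rw [krRate, neg_mul, neg_neg, mul_comm, Real.exp_nat_mul, Real.exp_log hc'0]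
  rw [hE2, hEs, hEst, hexp]
  -- the two observables on the slab
  have hMf : ∀ σ : SlabLink L T → Matrix.specialUnitaryGroup (Fin N) ℂ, |f (slices σ ⟨s, hsT⟩)| ≤ M :=
    fun σ => hM _
  have hMg : ∀ σ : SlabLink L T → Matrix.specialUnitaryGroup (Fin N) ℂ, |f (slices σ ⟨s + t, hstT⟩)| ≤ M :=
    fun σ => hM _
  -- the trivial bound
  have htriv : |(∫ σ, f (slices σ ⟨s, hsT⟩) * f (slices σ ⟨s + t, hstT⟩)
        ∂(weightMeasure ((slab (T := T) hL).energy (repWeight (fundamentalRep (Fin N)) β)))) -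
      (∫ σ, f (slices σ ⟨s, hsT⟩)
        ∂(weightMeasure ((slab (T := T) hL).energy (repWeight (fundamentalRep (Fin N)) β)))) *
      ∫ σ, f (slices σ ⟨s + t, hstT⟩)
        ∂(weightMeasure ((slab (T := T) hL).energy (repWeight (fundamentalRep (Fin N)) β)))| ≤ 2 * M ^ 2 :=
    calc _ ≤ |∫ σ, f (slices σ ⟨s, hsT⟩) * f (slices σ ⟨s + t, hstT⟩)
              ∂(weightMeasure ((slab (T := T) hL).energy (repWeight (fundamentalRep (Fin N)) β)))| +
            |(∫ σ, f (slices σ ⟨s, hsT⟩)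
              ∂(weightMeasure ((slab (T := T) hL).energy (repWeight (fundamentalRep (Fin N)) β)))) *
              ∫ σ, f (slices σ ⟨s + t, hstT⟩)
              ∂(weightMeasure ((slab (T := T) hL).energy (repWeight (fundamentalRep (Fin N)) β)))| :=
          abs_sub _ _
      _ ≤ M * M + M * M := by
          refine add_le_add (abs_integral_le_of_abs_le (abs_mul_le_of_abs_le hMf hMg)) ?_
          rw [abs_mul]
          exact mul_le_mul (abs_integral_le_of_abs_le hMf) (abs_integral_le_of_abs_le hMg) (abs_nonneg _) hM0
      _ = 2 * M ^ 2 := by ring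
  rcases Nat.lt_or_ge t 2 with ht2 | ht2
  · -- `t = 1`
    have ht1 : t = 1 := by omega
    rw [show max c (1 / 2) ^ t = max c (1 / 2) by rw [ht1, pow_one]]
    refine htriv.trans ?_
    nlinarith [mul_nonneg hA0 hc'0.le, mul_nonneg (sq_nonneg M) (sub_nonneg.2 hc'h)]
  · -- `t ≥ 2`: Föllmer's estimate on the slab
    have hsep : ∀ y ∈ (slab (T := T) hL).closure (sliceLinks ⟨s, hsT⟩), y ∉ sliceLinks ⟨s + t, hstT⟩ :=
      fun y hy => not_mem_sliceLinks_of_mem_closure hL (by simp only; omega) hy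
    have key := (slab (T := T) hL).abs_integral_mul_sub_le_su hN hK (by norm_num) (wdeg_slab_le hL) hR hmod hcc'
      hc'1 (hfm.comp ((measurable_pi_apply _).comp measurable_slices)) (dependsOn_slices f ⟨s, hsT⟩) hMf
      (hfm.comp ((measurable_pi_apply _).comp measurable_slices)) (dependsOn_slices f ⟨s + t, hstT⟩) hMg hsep
      (sliceProfile (s + t)) (fun y hy => sliceProfile_eq_zero_of_mem_closure hL hy)
      (fun x _ y hy => sliceProfile_nbr hL (s + t) hy)
    rw [hμ] at key
    have hsum1 : ∑ _y ∈ (slab (T := T) hL).closure (sliceLinks ⟨s + t, hstT⟩), M * suSmoothLip N 6 β ≤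
        ((3 * Fintype.card (Edge 3 L) + 2 * Fintype.card (Site 3 L) : ℕ) : ℝ) * (M * suSmoothLip N 6 β) := by
      rw [Finset.sum_const, nsmul_eq_mul]
      exact mul_le_mul_of_nonneg_right (by exact_mod_cast card_closure_sliceLinks_le hL _) hME
    have hsum2 : ∑ y ∈ (slab (T := T) hL).closure (sliceLinks ⟨s, hsT⟩),
        max c (1 / 2) ^ sliceProfile (s + t) y * (M * suSmoothLip N 6 β) ≤
        ((3 * Fintype.card (Edge 3 L) + 2 * Fintype.card (Site 3 L) : ℕ) : ℝ) *
          (max c (1 / 2) ^ (t - 2) * (M * suSmoothLip N 6 β)) :=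
      calc ∑ y ∈ (slab (T := T) hL).closure (sliceLinks ⟨s, hsT⟩),
            max c (1 / 2) ^ sliceProfile (s + t) y * (M * suSmoothLip N 6 β)
          ≤ ∑ _y ∈ (slab (T := T) hL).closure (sliceLinks ⟨s, hsT⟩),
              max c (1 / 2) ^ (t - 2) * (M * suSmoothLip N 6 β) := by
            refine Finset.sum_le_sum fun y hy => mul_le_mul_of_nonneg_right
              (pow_le_pow_of_le_one hc'0.le hc'1 ?_) hME
            have h := le_sliceProfile_of_mem_closure hL (s + t) hy
            simp only at h
            omega
        _ = ((slab (T := T) hL).closure (sliceLinks ⟨s, hsT⟩)).card *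
              (max c (1 / 2) ^ (t - 2) * (M * suSmoothLip N 6 β)) := by
            rw [Finset.sum_const, nsmul_eq_mul]
        _ ≤ _ := mul_le_mul_of_nonneg_right (by exact_mod_cast card_closure_sliceLinks_le hL _)
              (mul_nonneg (pow_nonneg hc'0.le _) hME)
    have hpow := pow_sub_two_le hc'h ht2
    calc _ ≤ _ := key
      _ ≤ 2 * (2 * Real.sqrt N) ^ 2 *
            (((3 * Fintype.card (Edge 3 L) + 2 * Fintype.card (Site 3 L) : ℕ) : ℝ) * (M * suSmoothLip N 6 β)) *
            (((3 * Fintype.card (Edge 3 L) + 2 * Fintype.card (Site 3 L) : ℕ) : ℝ) *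
              (max c (1 / 2) ^ (t - 2) * (M * suSmoothLip N 6 β))) :=
          mul_le_mul (mul_le_mul_of_nonneg_left hsum1 (by positivity)) hsum2
            (Finset.sum_nonneg fun y _ => mul_nonneg (pow_nonneg hc'0.le _) hME)
            (mul_nonneg (by positivity) (mul_nonneg (Nat.cast_nonneg _) hME))
      _ ≤ 2 * (2 * Real.sqrt N) ^ 2 *
            (((3 * Fintype.card (Edge 3 L) + 2 * Fintype.card (Site 3 L) : ℕ) : ℝ) * (M * suSmoothLip N 6 β)) *
            (((3 * Fintype.card (Edge 3 L) + 2 * Fintype.card (Site 3 L) : ℕ) : ℝ) *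
              (4 * max c (1 / 2) ^ t * (M * suSmoothLip N 6 β))) :=
          mul_le_mul_of_nonneg_left (mul_le_mul_of_nonneg_left (mul_le_mul_of_nonneg_right hpow hME)
            (Nat.cast_nonneg _)) (mul_nonneg (by positivity) (mul_nonneg (Nat.cast_nonneg _) hME))
      _ = 2 * (2 * Real.sqrt N) ^ 2 *
            (((3 * Fintype.card (Edge 3 L) + 2 * Fintype.card (Site 3 L) : ℕ) : ℝ) * (M * suSmoothLip N 6 β)) *
            (((3 * Fintype.card (Edge 3 L) + 2 * Fintype.card (Site 3 L) : ℕ) : ℝ) *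
              (4 * (M * suSmoothLip N 6 β))) * max c (1 / 2) ^ t := by ring
      _ ≤ _ := mul_le_mul_of_nonneg_right (le_add_of_nonneg_right (by positivity)) (pow_nonneg hc'0.le t)

/-- **SC-c in the Kantorovich–Rubinstein window**: under the hypotheses of
`openBoundaryTimeClustering_of_oneLinkKRModulus` and `β ≥ 0`, the Wilson transfer matrix of `SU(N)` on the spatial torus
`(ℤ/(2S+1))³` has a simple top eigenvalue and a spectral gap `≥ krRate c`, for EVERY `S ≥ 1` (the tree's
Osterwalder–Seiler/Lüscher conversion `transferOperatorGap_of_openBoundaryTimeClustering`). [folklore] -/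
theorem transferOperatorGap_of_oneLinkKRModulus {N : ℕ} (hN : 1 ≤ N) {β R K c : ℝ} (hK : 0 ≤ K)
    (hR : |β| / N * 6 ≤ R) (hmod : OneLinkKRModulus N R K) (hc : 18 * (|β| / N) * K ≤ c) (hc1 : c < 1)
    (hβ : 0 ≤ β) {S : ℕ} (hS : 1 ≤ S) : TransferOperatorGap (fundamentalRep (Fin N)) β S (krRate c) :=
  transferOperatorGap_of_openBoundaryTimeClustering (continuous_fundamentalRep (Fin N))
    fundamentalRep_mem_unitaryGroup hβ S
    (fun f hf B hB => show Measurable f ∧ ∃ B : ℝ, ∀ U, |f U| ≤ B from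
      ⟨hf, B, fun U => (Real.norm_eq_abs (f U)).symm.le.trans (hB U)⟩)
    (openBoundaryTimeClustering_of_oneLinkKRModulus (L := 2 * S + 1) (by omega) hN hK hR hmod hc hc1)

/-- **`CrossoverLedger.LatticeMassGap` (currency SC-c) in the Kantorovich–Rubinstein window**: a transfer-operator gap
`≥ krRate c > 0` uniformly in the spatial volume `(2S+1)³`, `S ≥ 1`. [folklore] -/
theorem latticeMassGap_of_oneLinkKRModulus {N : ℕ} (hN : 1 ≤ N) {β R K c : ℝ} (hK : 0 ≤ K)
    (hR : |β| / N * 6 ≤ R) (hmod : OneLinkKRModulus N R K) (hc : 18 * (|β| / N) * K ≤ c) (hc1 : c < 1)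
    (hβ : 0 ≤ β) : CrossoverLedger.LatticeMassGap (fundamentalRep (Fin N)) β (krRate c) :=
  ⟨krRate_pos hc1, 1, fun _ hS => transferOperatorGap_of_oneLinkKRModulus hN hK hR hmod hc hc1 hβ hS⟩

/-- **SC-c for every `SU(N)`, `N ≥ 2`, hypothesis-free, from the Bakry–Émery one-link modulus**
(`oneLinkKRModulus_SU`): `LatticeMassGap (fundamentalRep (Fin N)) β (krRate (18 (β/N) / (1/2 − 6β/N)))` for
`0 ≤ β < N/48` (tree coupling; Wilson `β_W = 2β` for `SU(2)`). [folklore] -/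
theorem latticeMassGap_SU {N : ℕ} (hN : 2 ≤ N) {β : ℝ} (hβ0 : 0 ≤ β) (hβ : β < N / 48) :
    CrossoverLedger.LatticeMassGap (fundamentalRep (Fin N)) β
      (krRate (18 * (β / N) * (1 / (1 / 2 - β / N * 6)))) := by
  have hN0 : (0 : ℝ) < N := by exact_mod_cast (show 0 < N by omega)
  have hx : β / N < 1 / 48 := by
    rw [div_lt_iff₀ hN0]
    linarith
  have hRlt : β / N * 6 < 1 / 2 := by linarith
  have hpos : 0 < 1 / 2 - β / N * 6 := by linarith
  have habs : |β| = β := abs_of_nonneg hβ0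
  refine latticeMassGap_of_oneLinkKRModulus (by omega) (R := β / N * 6) (K := 1 / (1 / 2 - β / N * 6))
    (one_div_pos.2 hpos).le (by rw [habs]) (oneLinkKRModulus_SU hN hRlt) (by rw [habs]) ?_ hβ0
  rw [← mul_div_assoc, mul_one, div_lt_one hpos]
  linarith

/-- **SC-c for `SU(2)` from any certified sharpened modulus** `OneLinkKRModulusSU2 βW K₂` with `18 βW K₂ < 1`
(Wilson coupling `βW`, tree coupling `βW/2`): `LatticeMassGap (fundamentalRep (Fin 2)) (βW/2) (krRate (18 βW K₂))`.
[folklore] -/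
theorem su2_latticeMassGap_of_oneLinkKRModulusSU2 {βW K₂ : ℝ} (h0 : 0 ≤ βW) (hK : 0 ≤ K₂)
    (hmod : OneLinkKRModulusSU2 βW K₂) (hwin : 18 * βW * K₂ < 1) :
    CrossoverLedger.LatticeMassGap (fundamentalRep (Fin 2)) (βW / 2) (krRate (18 * βW * K₂)) := by
  have habs : |βW / 2| = βW / 2 := abs_of_nonneg (by positivity)
  refine latticeMassGap_of_oneLinkKRModulus (N := 2) (by norm_num) (R := 3 * βW / 2) (K := 4 * K₂)
    (by positivity) ?_ hmod ?_ hwin (by positivity)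
  · rw [habs]; push_cast; linarith
  · rw [habs]; push_cast; linarith

/-- **SC-c, `SU(2)`, sharpened window**: for `0 ≤ β_W ≤ 1/6` with `81 β_W²(1+18β_W²+48β_W³) < 2(1−3β_W)`,
`LatticeMassGap (fundamentalRep (Fin 2)) (β_W/2) (krRate (18 β_W K₂(β_W)))`, `K₂` the modulus of
`oneLinkKRModulusSU2_sharp`. [folklore] -/
theorem su2_latticeMassGap_sharp {βW : ℝ} (h0 : 0 ≤ βW) (h6 : βW ≤ 1 / 6)
    (hwin : 81 * βW ^ 2 * (1 + 18 * βW ^ 2 + 48 * βW ^ 3) < 2 * (1 - 3 * βW)) :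
    CrossoverLedger.LatticeMassGap (fundamentalRep (Fin 2)) (βW / 2)
      (krRate (18 * βW * (Real.sqrt (2 * (1 + 18 * βW ^ 2 + 48 * βW ^ 3) / (1 - 3 * βW)) / 4))) :=
  su2_latticeMassGap_of_oneLinkKRModulusSU2 h0 (by positivity) (oneLinkKRModulusSU2_sharp h0 h6)
    (su2_window_sharp h0 h6 hwin)

/-- The sharpened window inequality holds on all of `0 ≤ β_W ≤ 1/9` (monotonicity; at `1/9` it reads `313/243 < 4/3`).
[folklore] -/
theorem su2_window_of_le_ninth {βW : ℝ} (h0 : 0 ≤ βW) (h9 : βW ≤ 1 / 9) :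
    81 * βW ^ 2 * (1 + 18 * βW ^ 2 + 48 * βW ^ 3) < 2 * (1 - 3 * βW) := by
  have h2 : βW ^ 2 ≤ (1 / 9 : ℝ) ^ 2 := pow_le_pow_left₀ h0 h9 2
  have h4 : βW ^ 4 ≤ (1 / 9 : ℝ) ^ 4 := pow_le_pow_left₀ h0 h9 4
  have h5 : βW ^ 5 ≤ (1 / 9 : ℝ) ^ 5 := pow_le_pow_left₀ h0 h9 5
  nlinarith [h2, h4, h5]

/-- **The `SU(2)`, `d = 4` transfer-operator mass gap (currency SC-c) holds, uniformly in the spatial volume, for every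
Wilson `0 ≤ β_W ≤ 1/9`, hypothesis-free**, at rate `krRate (18 β_W K₂(β_W))` (`= 0.01727…` at `β_W = 1/9`).
Observatory of the non-perturbative crossover; no mass-gap claim beyond the strong-coupling regime stated. [folklore] -/
theorem su2_latticeMassGap_ninth {βW : ℝ} (h0 : 0 ≤ βW) (h9 : βW ≤ 1 / 9) :
    CrossoverLedger.LatticeMassGap (fundamentalRep (Fin 2)) (βW / 2)
      (krRate (18 * βW * (Real.sqrt (2 * (1 + 18 * βW ^ 2 + 48 * βW ^ 3) / (1 - 3 * βW)) / 4))) :=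
  su2_latticeMassGap_sharp h0 (by linarith) (su2_window_of_le_ninth h0 h9)

/-- **SC-c at the ledger value `β_W = 1/9`** (tree coupling `1/18`). [folklore] -/
theorem su2_latticeMassGap_at_ninth :
    CrossoverLedger.LatticeMassGap (fundamentalRep (Fin 2)) ((1 / 9 : ℝ) / 2)
      (krRate (18 * (1 / 9 : ℝ) *
        (Real.sqrt (2 * (1 + 18 * (1 / 9 : ℝ) ^ 2 + 48 * (1 / 9 : ℝ) ^ 3) / (1 - 3 * (1 / 9 : ℝ))) / 4))) :=
  su2_latticeMassGap_ninth (by norm_num) le_rfl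

end Clustering

end Literature.MathematicalPhysics.QuantumFieldTheory.Balaban1983to89.StrongCouplingOpenWindow
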